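import Mathlib
import HarnessLib
import Summits.ResolutionOfSingularities.ResolutionOfSingularities.Theorems.WildQuotientsWildQuotientResolutionS1aMemberAwayRelations
import Summits.ResolutionOfSingularities.ResolutionOfSingularities.Theorems.WildQuotientsWildQuotientResolutionS1aFreeModelStep
import Summits.ResolutionOfSingularities.ResolutionOfSingularities.Theorems.WildQuotientsWildQuotientResolutionS1aQhSymChartIterates
import Summits.ResolutionOfSingularities.ResolutionOfSingularities.Theorems.WildQuotientsWildQuotientResolutionS1aQhSymChartNorms
import Summits.ResolutionOfSingularities.ResolutionOfSingularities.Theorems.WildQuotientsWildQuotientResolutionS1aCuspMemberZ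
import Summits.ResolutionOfSingularities.ResolutionOfSingularities.Theorems.WildQuotientsWildQuotientResolutionS1aChartBHat
import Summits.ResolutionOfSingularities.ResolutionOfSingularities.Theorems.WildQuotientsWildQuotientResolutionS1aAwayModelEquiv
import Summits.ResolutionOfSingularities.ResolutionOfSingularities.Theorems.WildQuotientsWildQuotientResolutionS1aCuspK1b
import Summits.ResolutionOfSingularities.ResolutionOfSingularities.Theorems.WildQuotientsWildQuotientResolutionS1aQhAwayMemberZ
import Summits.ResolutionOfSingularities.ResolutionOfSingularities.Theorems.WildQuotientsWildQuotientResolutionS1aQhAwayChartNorms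
import Summits.ResolutionOfSingularities.ResolutionOfSingularities.Theorems.WildQuotientsWildQuotientResolutionS1aCuspFLocus
import Summits.ResolutionOfSingularities.ResolutionOfSingularities.Theorems.WildQuotientsWildQuotientResolutionS1aA1Move2Model

/-!
# S1a — R4c cusp, (b5) INSTANTIATION at `Q`: the member chart `U_Q = [N(y)] ∩ D(N(h_Q))` presented by sections `a, b` with `a·(π^*ξf|U)³ = π^*x₀|U`,
`b·(π^*ξf|U)² = π^*f_Q|U` (`ξf = 2v + 2(1−3a)y − 3y²`, `subst ξf = s·h_Q`)

Recipe `Lines/s1a_logminvertex-R4c-PROGRESS.md` §5: copy of ✓`exists_cuspO_memberChart_rel` with the ✓QhRoot rows at `Q` (`y′ ↦ y′ + s²x′₀`, `v′` fixed,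
`x₃ ↦ x₃ + s²T′`), `Z := N_R(ĥ_Q)` (✓QhAwayMemberZ), `b′ := N(h_Q)^{dbar}`, K1′ ✓`isRegular_away_X_cuspGraphQ'` (certificate ✓`Cusp.cuspQ_x₂_not_mem`),
`u := h_Q` for both generators (`e = (3, 2)`).
-/

set_option linter.dupNamespace false

noncomputable section

open CategoryTheory Limits AlgebraicGeometry TopologicalSpace Topology Opposite MvPolynomial
open Literature.AlgebraicGeometry.Resolution Literature.AlgebraicGeometry.RelativeSpec
open scoped LaurentPolynomial
open Summit.ResolutionOfSingularities.ResolutionOfSingularities.Theorems.WildQuotientResolution.S1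
open Summit.ResolutionOfSingularities.ResolutionOfSingularities.Theorems.WildQuotientResolution.S1.NodeAtlas
open Summit.ResolutionOfSingularities.ResolutionOfSingularities.Theorems.WildQuotientResolution.S1.ProducerStep
open Summit.ResolutionOfSingularities.ResolutionOfSingularities.Theorems.WildQuotientResolution.S1.CoarseChart
open Summit.ResolutionOfSingularities.ResolutionOfSingularities.Theorems.WildQuotientResolution.S1.ReesBigrading
open Summit.ResolutionOfSingularities.ResolutionOfSingularities.Theorems.WildQuotientResolution.S1.NodeTransport
open Summit.ResolutionOfSingularities.ResolutionOfSingularities.Theorems.WildQuotientResolution.S1.CobordantTransport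
open Summit.ResolutionOfSingularities.ResolutionOfSingularities.Theorems.WildQuotientResolution.S1.KillCert
open Summit.ResolutionOfSingularities.ResolutionOfSingularities.Theorems.WildQuotientResolution.S1.BlowupCharts
open Summit.ResolutionOfSingularities.ResolutionOfSingularities.Theorems.WildQuotientResolution.S1.NodeAway
open Summit.ResolutionOfSingularities.ResolutionOfSingularities.Theorems.WildQuotientResolution.S1.CentreAway
open Summit.ResolutionOfSingularities.ResolutionOfSingularities.Theorems.WildQuotientResolution.S1.FreeModel
open Summit.ResolutionOfSingularities.ResolutionOfSingularities.Theorems.WildQuotientResolution.S1.NpFrame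
open Summit.ResolutionOfSingularities.ResolutionOfSingularities.Theorems.WildQuotientResolution.S1.GameFrame.GModel

namespace Summit.ResolutionOfSingularities.ResolutionOfSingularities.Theorems.WildQuotientResolution.S1.GameFrame.GModel

variable {p : ℕ} {X' X₁ : Scheme.{0}} {q : X' ⟶ X₁} {G : Type} [Group G] {ρ : G →* Aut X'} {g₀ : G}

set_option maxHeartbeats 8000000 in
set_option synthInstance.maxHeartbeats 400000 in
/-- ★★ **R4c LEVEL 2 AT `Q`, chart `[N(y)]` — the cusp member on `U_Q = [N(y)] ∩ D(b)`, `b̂ = N_R(ĥ_Q)^{dbar}·c^{-p}`, presented by sections** (`a·(π^*ξf|U)³ = π^*x₀|U`, `b·(π^*ξf|U)² = π^*f_Q|U` for the given pulled-back root sections `r₀ = π^*x₀`, `rξ = π^*ξf` (`ξf = 2x₂ + 2(1−3a)x₁ − 3x₁²` in `Q`-coordinates, `subst ξf = s·h_Q`), `r_t = π^*f_Q` of `W`), with `∃ d₀ > 0, ∀ l > 0` a principal-centre chart of degree `d₀ l` on `U_Q` whose filtration is the weighted filtration of `(a : 2, b : 1)` — the `Q`-point input of ✓`killsIn_one_of_sectionCharts`.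 Instance of ✓`exists_memberSections_away₂` (rows ✓`QhAway.qhc_*`, `w = (3,1,2)`, `sh = 2`, member-row unit and section normaliser `h_Q = 2(1−3a)y′ + 2s v′ − 3s y′²`, K1′ ✓`isRegular_away_X_cuspGraphQ'` with the certificate ✓`Cusp.cuspQ_x₂_not_mem`). [OURS · L1 W4.5c · R4c (b3′) Q-side; NOT a statement of the manuscript; counted 0] -/
theorem exists_cuspQ_memberChart_rel [Finite G] (hG : ∀ g : G, g ∈ Subgroup.zpowers g₀)
    {k : Type} [Field k] [Fact p.Prime] [CharP k p] (σ : (MvPolynomial (Fin 4) k) ≃+* (MvPolynomial (Fin 4) k)) (hC : ∀ a : k, σ (C a) = C a)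
    (a c : k) (ha : a ≠ 0) (hc0 : c ≠ 0) (hQ1 : 2 * c = 3 * a ^ 2) (hQ2 : c ^ 2 = a ^ 3) (h2k : (2 : k) ≠ 0) (he0 : (2 : k) * (1 - 3 * a) ≠ 0)
    (h0 : σ (X 0) = X 0) (h1 : σ (X 1) = X 1 + X 0) (h2 : σ (X 2) = X 2) (h3 : σ (X 3) = X 3 + (X 2 ^ 2 + 2 * X 1 * X 2 + C (2 * c) * X 2 + C (1 - 3 * a) * X 1 ^ 2 - X 1 ^ 3 : MvPolynomial (Fin 4) k))
    (hh : (MvPolynomial (Fin 4) k)) (hhh : hh = ∏ l : ZMod p, (X 1 + C a + (l.val : (MvPolynomial (Fin 4) k)) * X 0)) (hσh : σ hh = hh)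
    (hp : 0 < p) (hσpL : ∀ y : (Localization.Away hh), (⇑(sigmaAway σ hσh))^[p] y = y)
    (hσJ : ∀ n : ℕ, ((weightedFiltration (fun i => algebraMap (MvPolynomial (Fin 4) k) (Localization.Away hh) (X ((![0, 1, 2] : Fin 3 → Fin 4) i))) (![3, 1, 2] : Fin 3 → ℕ)).ideal n).map ((sigmaAway σ hσh) : (Localization.Away hh) →+* (Localization.Away hh)) ≤ (weightedFiltration (fun i => algebraMap (MvPolynomial (Fin 4) k) (Localization.Away hh) (X ((![0, 1, 2] : Fin 3 → Fin 4) i))) (![3, 1, 2] : Fin 3 → ℕ)).ideal n)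
    (ht : algebraMap (MvPolynomial (Fin 4) k) (Localization.Away hh) (X 2 ^ 2 + 2 * X 1 * X 2 + C (2 * c) * X 2 + C (1 - 3 * a) * X 1 ^ 2 - X 1 ^ 3 : MvPolynomial (Fin 4) k) ∈ (weightedFiltration (fun i => algebraMap (MvPolynomial (Fin 4) k) (Localization.Away hh) (X ((![0, 1, 2] : Fin 3 → Fin 4) i))) (![3, 1, 2] : Fin 3 → ℕ)).ideal 2)
    {mg : ℕ} (mo : Fin mg → ℕ) (𝒜 : (Π j : Fin mg, ZMod (mo j)) → AddSubgroup (Localization.Away hh)) [GradedRing 𝒜] (hfull : ∀ (d : Π j : Fin mg, ZMod (mo j)) (x : (Localization.Away hh)), x ∈ 𝒜 d)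
    (hf : ∀ i, (fun i => algebraMap (MvPolynomial (Fin 4) k) (Localization.Away hh) (X ((![0, 1, 2] : Fin 3 → Fin 4) i))) i ∈ 𝒜 ((fun _ => (0 : Π j : Fin mg, ZMod (mo j))) i))
    {dbar : ℕ} (y : ↥(𝒜 0)) (hy : y ∈ (traceFiltration 𝒜 (fun i => algebraMap (MvPolynomial (Fin 4) k) (Localization.Away hh) (X ((![0, 1, 2] : Fin 3 → Fin 4) i))) (![3, 1, 2] : Fin 3 → ℕ)).ideal dbar) (hσy : (sigmaAway σ hσh) (y : (Localization.Away hh)) = y)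
    {n₁ : ℕ}
    (hc1 : (coverElement 𝒜 (fun i => algebraMap (MvPolynomial (Fin 4) k) (Localization.Away hh) (X ((![0, 1, 2] : Fin 3 → Fin 4) i))) (![3, 1, 2] : Fin 3 → ℕ) dbar y hy) = (∏ l : ZMod p, ((cobordantAlgebra.u' (fun i => algebraMap (MvPolynomial (Fin 4) k) (Localization.Away hh) (X ((![0, 1, 2] : Fin 3 → Fin 4) i))) (![3, 1, 2] : Fin 3 → ℕ) 1) + algebraMap (Localization.Away hh) ↥(cobordantAlgebra (fun i => algebraMap (MvPolynomial (Fin 4) k) (Localization.Away hh) (X ((![0, 1, 2] : Fin 3 → Fin 4) i))) (![3, 1, 2] : Fin 3 → ℕ)) (l.val : (Localization.Away hh)) * ((cobordantAlgebra.u' (fun i => algebraMap (MvPolynomial (Fin 4) k) (Localization.Away hh) (X ((![0, 1, 2] : Fin 3 → Fin 4) i))) (![3, 1, 2] : Fin 3 → ℕ) 0) * (cobordantAlgebra.s (fun i => algebraMap (MvPolynomial (Fin 4) k) (Localization.Away hh) (X ((![0, 1, 2] : Fin 3 → Fin 4) i))) (![3, 1, 2] : Fin 3 → ℕ)) ^ 2)))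 ^ n₁) (hdbar : 0 < dbar)
    (M : GModel p q G ρ g₀) [M.V.IsSeparated] (W : M.act.StableAffineOpens) (hW : IsAffineOpen W.1)
    (E : letI := chartNodeGradedRing mo 𝒜 (fun i => algebraMap (MvPolynomial (Fin 4) k) (Localization.Away hh) (X ((![0, 1, 2] : Fin 3 → Fin 4) i))) (![3, 1, 2] : Fin 3 → ℕ) hf dbar y hy; Γ(M.V, W.1) ≃+* ↥((chartNodeGrading mo 𝒜 (fun i => algebraMap (MvPolynomial (Fin 4) k) (Localization.Away hh) (X ((![0, 1, 2] : Fin 3 → Fin 4) i))) (![3, 1, 2] : Fin 3 → ℕ) hf dbar y hy) 0))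
    (htame : letI := chartNodeGradedRing mo 𝒜 (fun i => algebraMap (MvPolynomial (Fin 4) k) (Localization.Away hh) (X ((![0, 1, 2] : Fin 3 → Fin 4) i))) (![3, 1, 2] : Fin 3 → ℕ) hf dbar y hy; IsTameNode p (ChartRing 𝒜 (fun i => algebraMap (MvPolynomial (Fin 4) k) (Localization.Away hh) (X ((![0, 1, 2] : Fin 3 → Fin 4) i))) (![3, 1, 2] : Fin 3 → ℕ) dbar y hy) (chartNodeGrading mo 𝒜 (fun i => algebraMap (MvPolynomial (Fin 4) k) (Localization.Away hh) (X ((![0, 1, 2] : Fin 3 → Fin 4) i))) (![3, 1, 2] : Fin 3 → ℕ) hf dbar y hy) (sigmaChart 𝒜 (fun i => algebraMap (MvPolynomial (Fin 4) k) (Localization.Away hh) (X ((![0, 1, 2] : Fin 3 → Fin 4) i))) (![3, 1, 2] : Fin 3 → ℕ) dbar y hy (sigmaAway σ hσh) hσJ hp hσpL hσy))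
    (hE : letI := chartNodeGradedRing mo 𝒜 (fun i => algebraMap (MvPolynomial (Fin 4) k) (Localization.Away hh) (X ((![0, 1, 2] : Fin 3 → Fin 4) i))) (![3, 1, 2] : Fin 3 → ℕ) hf dbar y hy
      ∀ t' : Γ(M.V, W.1), ((E ((M.act.aut g₀⁻¹).hom.appLE W.1 W.1 (W.2.1 g₀⁻¹).ge t') : ↥((chartNodeGrading mo 𝒜 (fun i => algebraMap (MvPolynomial (Fin 4) k) (Localization.Away hh) (X ((![0, 1, 2] : Fin 3 → Fin 4) i))) (![3, 1, 2] : Fin 3 → ℕ) hf dbar y hy) 0)) : (ChartRing 𝒜 (fun i => algebraMap (MvPolynomial (Fin 4) k) (Localization.Away hh) (X ((![0, 1, 2] : Fin 3 → Fin 4) i))) (![3, 1, 2] : Fin 3 → ℕ) dbar y hy)) = (sigmaChart 𝒜 (fun i => algebraMap (MvPolynomial (Fin 4) k) (Localization.Away hh) (X ((![0, 1, 2] : Fin 3 → Fin 4) i))) (![3, 1, 2] : Fin 3 → ℕ) dbar y hy (sigmaAway σ hσh) hσJ hp hσpL hσy) ((E t' : ↥((chartNodeGrading mo 𝒜 (fun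 i => algebraMap (MvPolynomial (Fin 4) k) (Localization.Away hh) (X ((![0, 1, 2] : Fin 3 → Fin 4) i))) (![3, 1, 2] : Fin 3 → ℕ) hf dbar y hy) 0)) : (ChartRing 𝒜 (fun i => algebraMap (MvPolynomial (Fin 4) k) (Localization.Away hh) (X ((![0, 1, 2] : Fin 3 → Fin 4) i))) (![3, 1, 2] : Fin 3 → ℕ) dbar y hy)))
    -- the pulled-back root sections, by their chart values
    (r0 rxi rt : Γ(M.V, W.1))
    (hr0 : letI := chartNodeGradedRing mo 𝒜 (fun i => algebraMap (MvPolynomial (Fin 4) k) (Localization.Away hh) (X ((![0, 1, 2] : Fin 3 → Fin 4) i))) (![3, 1, 2] : Fin 3 → ℕ) hf dbar y hy; ((E r0 : ↥((chartNodeGrading mo 𝒜 (fun i => algebraMap (MvPolynomial (Fin 4) k) (Localization.Away hh) (X ((![0, 1, 2] : Fin 3 → Fin 4) i))) (![3, 1, 2] : Fin 3 → ℕ) hf dbar y hy) 0)) : (ChartRing 𝒜 (fun i => algebraMap (MvPolynomial (Fin 4) k) (Localization.Away hh) (X ((![0, 1, 2] : Fin 3 → Fin 4) i))) (![3, 1,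 2] : Fin 3 → ℕ) dbar y hy)) = algebraMap ↥(cobordantAlgebra (fun i => algebraMap (MvPolynomial (Fin 4) k) (Localization.Away hh) (X ((![0, 1, 2] : Fin 3 → Fin 4) i))) (![3, 1, 2] : Fin 3 → ℕ)) (ChartRing 𝒜 (fun i => algebraMap (MvPolynomial (Fin 4) k) (Localization.Away hh) (X ((![0, 1, 2] : Fin 3 → Fin 4) i))) (![3, 1, 2] : Fin 3 → ℕ) dbar y hy) (algebraMap (Localization.Away hh) ↥(cobordantAlgebra (fun i => algebraMap (MvPolynomial (Fin 4) k) (Localization.Away hh) (X ((![0, 1, 2] : Fin 3 → Fin 4) i))) (![3, 1, 2] : Fin 3 → ℕ)) ((fun i => algebraMap (MvPolynomial (Fin 4) k) (Localization.Away hh) (X ((![0, 1, 2] : Fin 3 → Fin 4) i))) 0)))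
    (hrxi : letI := chartNodeGradedRing mo 𝒜 (fun i => algebraMap (MvPolynomial (Fin 4) k) (Localization.Away hh) (X ((![0, 1, 2] : Fin 3 → Fin 4) i))) (![3, 1, 2] : Fin 3 → ℕ) hf dbar y hy; ((E rxi : ↥((chartNodeGrading mo 𝒜 (fun i => algebraMap (MvPolynomial (Fin 4) k) (Localization.Away hh) (X ((![0, 1, 2] : Fin 3 → Fin 4) i))) (![3, 1, 2] : Fin 3 → ℕ) hf dbar y hy) 0)) : (ChartRing 𝒜 (fun i => algebraMap (MvPolynomial (Fin 4) k) (Localization.Away hh) (X ((![0, 1, 2] : Fin 3 → Fin 4) i))) (![3, 1, 2] : Fin 3 → ℕ) dbar y hy)) = algebraMap ↥(cobordantAlgebra (fun i => algebraMap (MvPolynomial (Fin 4) k) (Localization.Away hh) (X ((![0, 1, 2] : Fin 3 → Fin 4) i))) (![3, 1, 2] : Fin 3 → ℕ)) (ChartRing 𝒜 (fun i => algebraMap (MvPolynomial (Fin 4) k) (Localization.Away hh) (X ((![0, 1, 2] : Fin 3 → Fin 4) i))) (![3, 1, 2] : Fin 3 → ℕ) dbar y hy) (algebraMap (Localization.Away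 hh) ↥(cobordantAlgebra (fun i => algebraMap (MvPolynomial (Fin 4) k) (Localization.Away hh) (X ((![0, 1, 2] : Fin 3 → Fin 4) i))) (![3, 1, 2] : Fin 3 → ℕ)) (algebraMap (MvPolynomial (Fin 4) k) (Localization.Away hh) (2 * X 2 + C (2 * (1 - 3 * a)) * X 1 - 3 * X 1 ^ 2 : MvPolynomial (Fin 4) k))))
    (hrt : letI := chartNodeGradedRing mo 𝒜 (fun i => algebraMap (MvPolynomial (Fin 4) k) (Localization.Away hh) (X ((![0, 1, 2] : Fin 3 → Fin 4) i))) (![3, 1, 2] : Fin 3 → ℕ) hf dbar y hy; ((E rt : ↥((chartNodeGrading mo 𝒜 (fun i => algebraMap (MvPolynomial (Fin 4) k) (Localization.Away hh) (X ((![0, 1, 2] : Fin 3 → Fin 4) i))) (![3, 1, 2] : Fin 3 → ℕ) hf dbar y hy) 0)) : (ChartRing 𝒜 (fun i => algebraMap (MvPolynomial (Fin 4) k) (Localization.Away hh) (X ((![0, 1, 2] : Fin 3 → Fin 4) i))) (![3, 1, 2] : Fin 3 → ℕ) dbar y hy)) = algebraMap ↥(cobordantAlgebra (fun i => algebraMap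 (MvPolynomial (Fin 4) k) (Localization.Away hh) (X ((![0, 1, 2] : Fin 3 → Fin 4) i))) (![3, 1, 2] : Fin 3 → ℕ)) (ChartRing 𝒜 (fun i => algebraMap (MvPolynomial (Fin 4) k) (Localization.Away hh) (X ((![0, 1, 2] : Fin 3 → Fin 4) i))) (![3, 1, 2] : Fin 3 → ℕ) dbar y hy) (algebraMap (Localization.Away hh) ↥(cobordantAlgebra (fun i => algebraMap (MvPolynomial (Fin 4) k) (Localization.Away hh) (X ((![0, 1, 2] : Fin 3 → Fin 4) i))) (![3, 1, 2] : Fin 3 → ℕ)) (algebraMap (MvPolynomial (Fin 4) k) (Localization.Away hh) (X 2 ^ 2 + 2 * X 1 * X 2 + C (2 * c) * X 2 + C (1 - 3 * a) * X 1 ^ 2 - X 1 ^ 3 : MvPolynomial (Fin 4) k)))) :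
    letI := chartNodeGradedRing mo 𝒜 (fun i => algebraMap (MvPolynomial (Fin 4) k) (Localization.Away hh) (X ((![0, 1, 2] : Fin 3 → Fin 4) i))) (![3, 1, 2] : Fin 3 → ℕ) hf dbar y hy
    ∃ (b : Γ(M.V, W.1)) (U : M.act.StableAffineOpens) (hUW : U.1 ≤ W.1) (_ : U.1 = M.V.basicOpen b),
      ((E b : ↥((chartNodeGrading mo 𝒜 (fun i => algebraMap (MvPolynomial (Fin 4) k) (Localization.Away hh) (X ((![0, 1, 2] : Fin 3 → Fin 4) i))) (![3, 1, 2] : Fin 3 → ℕ) hf dbar y hy) 0)) : (ChartRing 𝒜 (fun i => algebraMap (MvPolynomial (Fin 4) k) (Localization.Away hh) (X ((![0, 1, 2] : Fin 3 → Fin 4) i))) (![3, 1, 2] : Fin 3 → ℕ) dbar y hy)) = algebraMap ↥(cobordantAlgebra (fun i => algebraMap (MvPolynomial (Fin 4) k) (Localization.Away hh) (X ((![0, 1, 2] : Fin 3 → Fin 4) i))) (![3, 1, 2] : Fin 3 → ℕ)) (ChartRing 𝒜 (fun i => algebraMap (MvPolynomial (Fin 4) k) (Localization.Away hh) (X ((![0,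 1, 2] : Fin 3 → Fin 4) i))) (![3, 1, 2] : Fin 3 → ℕ) dbar y hy) ((∏ j : ZMod p, (⇑(sigmaR (sigmaAway σ hσh) (fun i => algebraMap (MvPolynomial (Fin 4) k) (Localization.Away hh) (X ((![0, 1, 2] : Fin 3 → Fin 4) i))) (![3, 1, 2] : Fin 3 → ℕ) hσJ hp hσpL))^[j.val] ((algebraMap (Localization.Away hh) ↥(cobordantAlgebra (fun i => algebraMap (MvPolynomial (Fin 4) k) (Localization.Away hh) (X ((![0, 1, 2] : Fin 3 → Fin 4) i))) (![3, 1, 2] : Fin 3 → ℕ)) (algebraMap (MvPolynomial (Fin 4) k) (Localization.Away hh) (C (2 * (1 - 3 * a))))) * (cobordantAlgebra.u' (fun i => algebraMap (MvPolynomial (Fin 4) k) (Localization.Away hh) (X ((![0, 1, 2] : Fin 3 → Fin 4) i))) (![3, 1, 2] : Fin 3 → ℕ) 1) + 2 * (cobordantAlgebra.s (fun i => algebraMap (MvPolynomial (Fin 4) k) (Localization.Away hh) (X ((![0, 1, 2] : Fin 3 → Fin 4) i))) (![3, 1, 2] : Fin 3 → ℕ)) * (cobordantAlgebra.u' (fun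 i => algebraMap (MvPolynomial (Fin 4) k) (Localization.Away hh) (X ((![0, 1, 2] : Fin 3 → Fin 4) i))) (![3, 1, 2] : Fin 3 → ℕ) 2) - 3 * (cobordantAlgebra.s (fun i => algebraMap (MvPolynomial (Fin 4) k) (Localization.Away hh) (X ((![0, 1, 2] : Fin 3 → Fin 4) i))) (![3, 1, 2] : Fin 3 → ℕ)) * (cobordantAlgebra.u' (fun i => algebraMap (MvPolynomial (Fin 4) k) (Localization.Away hh) (X ((![0, 1, 2] : Fin 3 → Fin 4) i))) (![3, 1, 2] : Fin 3 → ℕ) 1) ^ 2)) ^ dbar) *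
        IsLocalization.Away.invSelf (coverElement 𝒜 (fun i => algebraMap (MvPolynomial (Fin 4) k) (Localization.Away hh) (X ((![0, 1, 2] : Fin 3 → Fin 4) i))) (![3, 1, 2] : Fin 3 → ℕ) dbar y hy) ^ (1 * p) ∧
      ∃ (a' bb : Γ(M.V, U.1)),
        a' * (M.V.presheaf.map (homOfLE hUW).op).hom rxi ^ 3 = (M.V.presheaf.map (homOfLE hUW).op).hom r0 ∧
        bb * (M.V.presheaf.map (homOfLE hUW).op).hom rxi ^ 2 = (M.V.presheaf.map (homOfLE hUW).op).hom rt ∧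
        ∃ d₀ : ℕ, 0 < d₀ ∧ ∀ l : ℕ, 0 < l → ∃ 𝒦₀ : ReesFiltration M.V, IsPrincipalCentreChart p M.act g₀ 𝒦₀ (d₀ * l) U ∧
          ∀ (U' : M.V.affineOpens) (hU : U'.1 ≤ U.1) (n : ℕ), (𝒦₀.filtration U').ideal n =
            (weightedFiltration (fun l' => (M.V.presheaf.map (homOfLE hU).op).hom ((![a', bb] : Fin 2 → Γ(M.V, U.1)) l')) ![2, 1]).ideal n := by
  classical
  letI instN := chartNodeGradedRing mo 𝒜 (fun i => algebraMap (MvPolynomial (Fin 4) k) (Localization.Away hh) (X ((![0, 1, 2] : Fin 3 → Fin 4) i))) (![3, 1, 2] : Fin 3 → ℕ) hf dbar y hy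
  haveI : NeZero p := ⟨hp.ne'⟩
  have hp1 : p ≠ 1 := (Fact.out : p.Prime).ne_one
  have hw0 : (![3, 1, 2] : Fin 3 → ℕ) 0 = (![3, 1, 2] : Fin 3 → ℕ) 1 + 2 := by decide
  -- ### the pinned free model of the producer chart ring
  have hvW : ∀ i : Fin 3, (![3, 1, 2, 0] : Fin 4 → ℕ) ((![0, 1, 2] : Fin 3 → Fin 4) i) = (![3, 1, 2] : Fin 3 → ℕ) i := fun i => by fin_cases i <;> rfl
  have hWv : ∀ l : Fin 4, (![3, 1, 2, 0] : Fin 4 → ℕ) l = 0 ∨ ∃ i : Fin 3, (![0, 1, 2] : Fin 3 → Fin 4) i = l := fun l => by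
    fin_cases l
    exacts [Or.inr ⟨0, rfl⟩, Or.inr ⟨1, rfl⟩, Or.inr ⟨2, rfl⟩, Or.inl rfl]
  have hz : ∀ Ψ : ↥(cobordantAlgebra (fun i => algebraMap (MvPolynomial (Fin 4) k) (Localization.Away hh) (X ((![0, 1, 2] : Fin 3 → Fin 4) i))) (![3, 1, 2] : Fin 3 → ℕ)) ≃+* Localization.Away (cobordantAlgebra.subst k (![3, 1, 2, 0] : Fin 4 → ℕ) hh),
      (∀ a : (MvPolynomial (Fin 4) k), Ψ (algebraMap (Localization.Away hh) ↥(cobordantAlgebra (fun i => algebraMap (MvPolynomial (Fin 4) k) (Localization.Away hh) (X ((![0, 1, 2] : Fin 3 → Fin 4) i))) (![3, 1, 2] : Fin 3 → ℕ)) (algebraMap (MvPolynomial (Fin 4) k) (Localization.Away hh) a)) = algebraMap (MvPolynomial (Option (Fin 4)) k) _ (cobordantAlgebra.subst k (![3, 1, 2, 0] : Fin 4 → ℕ) a)) →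
      Ψ (cobordantAlgebra.s (fun i => algebraMap (MvPolynomial (Fin 4) k) (Localization.Away hh) (X ((![0, 1, 2] : Fin 3 → Fin 4) i))) (![3, 1, 2] : Fin 3 → ℕ)) = algebraMap (MvPolynomial (Option (Fin 4)) k) _ (X none) →
      (∀ i, Ψ (cobordantAlgebra.u' (fun i => algebraMap (MvPolynomial (Fin 4) k) (Localization.Away hh) (X ((![0, 1, 2] : Fin 3 → Fin 4) i))) (![3, 1, 2] : Fin 3 → ℕ) i) = algebraMap (MvPolynomial (Option (Fin 4)) k) _ (X (some ((![0, 1, 2] : Fin 3 → Fin 4) i)))) →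
      Associated (algebraMap (MvPolynomial (Option (Fin 4)) k) (Localization.Away (cobordantAlgebra.subst k (![3, 1, 2, 0] : Fin 4 → ℕ) hh)) ((∏ l : ZMod p, (X (some 1) + (l.val : (MvPolynomial (Option (Fin 4)) k)) * (X none ^ 2 * X (some 0)))) ^ n₁)) (Ψ (coverElement 𝒜 (fun i => algebraMap (MvPolynomial (Fin 4) k) (Localization.Away hh) (X ((![0, 1, 2] : Fin 3 → Fin 4) i))) (![3, 1, 2] : Fin 3 → ℕ) dbar y hy)) := by
    intro Ψ hΨa hΨs hΨu
    have heq : Ψ (coverElement 𝒜 (fun i => algebraMap (MvPolynomial (Fin 4) k) (Localization.Away hh) (X ((![0, 1, 2] : Fin 3 → Fin 4) i))) (![3, 1, 2] : Fin 3 → ℕ) dbar y hy) = algebraMap (MvPolynomial (Option (Fin 4)) k) (Localization.Away (cobordantAlgebra.subst k (![3, 1, 2, 0] : Fin 4 → ℕ) hh)) ((∏ l : ZMod p, (X (some 1) + (l.val : (MvPolynomial (Option (Fin 4)) k)) * (X none ^ 2 * X (some 0)))) ^ n₁) := by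
      rw [hc1, map_pow, map_prod, map_pow, map_prod]
      refine congrArg (· ^ n₁) (Finset.prod_congr rfl fun l _ => ?_)
      simp only [map_add, map_mul, map_pow, map_natCast, hΨu 1, hΨu 0, hΨs, Matrix.cons_val_one, Matrix.cons_val_zero]
      ring
    rw [heq]
  obtain ⟨Φ, hΦa, hΦs, hΦu⟩ := FreeModel.exists_chartFreeModelEquiv k (![3, 1, 2, 0] : Fin 4 → ℕ) hh (![0, 1, 2] : Fin 3 → Fin 4) (![3, 1, 2] : Fin 3 → ℕ) hvW hWv (fun i => algebraMap (MvPolynomial (Fin 4) k) (Localization.Away hh) (X ((![0, 1, 2] : Fin 3 → Fin 4) i))) (fun _ => rfl) 𝒜 dbar y hy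
    ((∏ l : ZMod p, (X (some 1) + (l.val : (MvPolynomial (Option (Fin 4)) k)) * (X none ^ 2 * X (some 0)))) ^ n₁) hz
  -- ### `subst hh`, the `k`-point, `q ≠ 0`
  have hsubX : ∀ i : Fin 4, cobordantAlgebra.subst k (![3, 1, 2, 0] : Fin 4 → ℕ) (X i) = X none ^ (![3, 1, 2, 0] : Fin 4 → ℕ) i * X (some i) := fun i => by
    rw [cobordantAlgebra.subst, MvPolynomial.eval₂Hom_X']
  have hsubC : ∀ a' : k, cobordantAlgebra.subst k (![3, 1, 2, 0] : Fin 4 → ℕ) (C a') = C a' := fun a' => by rw [cobordantAlgebra.subst, MvPolynomial.eval₂Hom_C]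
  have hsubst_hh : cobordantAlgebra.subst k (![3, 1, 2, 0] : Fin 4 → ℕ) hh = ∏ l : ZMod p, (X none ^ 1 * X (some 1) + C a + (l.val : (MvPolynomial (Option (Fin 4)) k)) * (X none ^ 3 * X (some 0))) := by
    rw [hhh, map_prod]
    refine Finset.prod_congr rfl fun l _ => ?_
    rw [map_add, map_add, map_mul, map_natCast, hsubX, hsubX, hsubC]
    rfl
  -- the `k`-point `(s; x′₀, y′, v′, x₃) = (0; 0, 1, v₀, 0)`, `v₀ = −(1−3a)/(2c)`, and `q·b′ ≠ 0`
  have hupt : MvPolynomial.eval (fun o : Option (Fin 4) => o.elim (0 : k) ![0, 1, -(1 - 3 * a) / (2 * c), 0]) ((cobordantAlgebra.subst k (![3, 1, 2, 0] : Fin 4 → ℕ) hh * (∏ l : ZMod p, (X (some 1) + (l.val : (MvPolynomial (Option (Fin 4)) k)) * (X none ^ 2 * X (some 0)))) ^ n₁) * ((∏ l : ZMod p, (C (2 * (1 - 3 * a)) * (X (some 1) + (l.val : (MvPolynomial (Option (Fin 4)) k)) * (X none ^ 2 * X (some 0))) + 2 * X none * X (some 2) - 3 * X none * (X (some 1) +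 (l.val : (MvPolynomial (Option (Fin 4)) k)) * (X none ^ 2 * X (some 0))) ^ 2)) ^ dbar)) ≠ 0 := by
    rw [map_mul, map_mul, map_pow, hsubst_hh, map_pow]
    simp only [map_prod, map_add, map_sub, map_mul, map_pow, map_natCast, MvPolynomial.eval_X, MvPolynomial.eval_C, map_ofNat,
      Option.elim_none, Option.elim_some, Matrix.cons_val_zero, Matrix.cons_val_one,
      ne_eq, zero_pow (Nat.succ_ne_zero _), mul_zero, zero_mul, add_zero, zero_add, mul_one, one_pow, sub_zero, Finset.prod_const, Finset.card_univ, ZMod.card]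
    first
      | exact mul_ne_zero (mul_ne_zero (pow_ne_zero _ ha) (one_ne_zero)) (pow_ne_zero _ (pow_ne_zero _ he0))
      | exact mul_ne_zero (pow_ne_zero _ ha) (pow_ne_zero _ (pow_ne_zero _ he0))
  have hq0 : (cobordantAlgebra.subst k (![3, 1, 2, 0] : Fin 4 → ℕ) hh * (∏ l : ZMod p, (X (some 1) + (l.val : (MvPolynomial (Option (Fin 4)) k)) * (X none ^ 2 * X (some 0)))) ^ n₁) * ((∏ l : ZMod p, (C (2 * (1 - 3 * a)) * (X (some 1) + (l.val : (MvPolynomial (Option (Fin 4)) k)) * (X none ^ 2 * X (some 0))) + 2 * X none * X (some 2) - 3 * X none * (X (some 1) + (l.val : (MvPolynomial (Option (Fin 4)) k)) * (X none ^ 2 * X (some 0))) ^ 2)) ^ dbar) ≠ 0 := fun h => hupt (by rw [h, map_zero])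
  have hQD0 : (cobordantAlgebra.subst k (![3, 1, 2, 0] : Fin 4 → ℕ) hh * (∏ l : ZMod p, (X (some 1) + (l.val : (MvPolynomial (Option (Fin 4)) k)) * (X none ^ 2 * X (some 0)))) ^ n₁) ≠ 0 := left_ne_zero_of_mul hq0
  haveI : CharP (Localization.Away (cobordantAlgebra.subst k (![3, 1, 2, 0] : Fin 4 → ℕ) hh * (∏ l : ZMod p, (X (some 1) + (l.val : (MvPolynomial (Option (Fin 4)) k)) * (X none ^ 2 * X (some 0)))) ^ n₁)) p := charP_of_injective_ringHom (IsLocalization.injective (Localization.Away (cobordantAlgebra.subst k (![3, 1, 2, 0] : Fin 4 → ℕ) hh * (∏ l : ZMod p, (X (some 1) + (l.val : (MvPolynomial (Option (Fin 4)) k)) * (X none ^ 2 * X (some 0)))) ^ n₁)) (powers_le_nonZeroDivisors_of_noZeroDivisors hQD0)) p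
  -- ### rows of `τ′ = conj Φ σ_chart` in the producer model; `τ′` fixes `q` and `b′`
  obtain ⟨rn, row0, row2, rC⟩ := KillCert.QhAway.qhc_rows_fixed σ hC h0 h1 h2 (X 2 ^ 2 + 2 * X 1 * X 2 + C (2 * c) * X 2 + C (1 - 3 * a) * X 1 ^ 2 - X 1 ^ 3 : MvPolynomial (Fin 4) k) h3 (![3, 1, 2] : Fin 3 → ℕ) hh hσh hp hσpL hσJ mo 𝒜 y hy hσy Φ hΦa hΦs hΦu
  have row1 := KillCert.QhAway.qhc_row_one σ h0 h1 h2 (X 2 ^ 2 + 2 * X 1 * X 2 + C (2 * c) * X 2 + C (1 - 3 * a) * X 1 ^ 2 - X 1 ^ 3 : MvPolynomial (Fin 4) k) h3 (![3, 1, 2] : Fin 3 → ℕ) 2 hw0 hh hσh hp hσpL hσJ mo 𝒜 y hy hσy Φ hΦs hΦu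
  have hT' : cobordantAlgebra.subst k (![3, 1, 2, 0] : Fin 4 → ℕ) (X 2 ^ 2 + 2 * X 1 * X 2 + C (2 * c) * X 2 + C (1 - 3 * a) * X 1 ^ 2 - X 1 ^ 3 : MvPolynomial (Fin 4) k) = X none ^ 2 * (X none ^ 2 * X (some 2) ^ 2 + 2 * X none * X (some 2) * X (some 1) + C (2 * c) * X (some 2) + C (1 - 3 * a) * X (some 1) ^ 2 - X none * X (some 1) ^ 3 : MvPolynomial (Option (Fin 4)) k) := KillCert.QhSym.subst_cuspTailQ (k := k) a c
  have row3 := KillCert.QhAway.qhc_row_three σ (X 2 ^ 2 + 2 * X 1 * X 2 + C (2 * c) * X 2 + C (1 - 3 * a) * X 1 ^ 2 - X 1 ^ 3 : MvPolynomial (Fin 4) k) h3 (![3, 1, 2] : Fin 3 → ℕ) 2 hh hσh hp hσpL hσJ mo 𝒜 y hy hσy Φ hΦa (X none ^ 2 * X (some 2) ^ 2 + 2 * X none * X (some 2) * X (some 1) + C (2 * c) * X (some 2) + C (1 - 3 * a) * X (some 1) ^ 2 - X none * X (some 1) ^ 3 : MvPolynomial (Option (Fin 4)) k) hT'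
  have hφeq := KillCert.QhAway.qhc_tail_eq (X 2 ^ 2 + 2 * X 1 * X 2 + C (2 * c) * X 2 + C (1 - 3 * a) * X 1 ^ 2 - X 1 ^ 3 : MvPolynomial (Fin 4) k) (![3, 1, 2] : Fin 3 → ℕ) 2 hh mo 𝒜 y hy hQD0 Φ hΦa hΦs ht (X none ^ 2 * X (some 2) ^ 2 + 2 * X none * X (some 2) * X (some 1) + C (2 * c) * X (some 2) + C (1 - 3 * a) * X (some 1) ^ 2 - X none * X (some 1) ^ 3 : MvPolynomial (Option (Fin 4)) k) hT'
  have hrs : conj Φ (sigmaChart 𝒜 (fun i => algebraMap (MvPolynomial (Fin 4) k) (Localization.Away hh) (X ((![0, 1, 2] : Fin 3 → Fin 4) i))) (![3, 1, 2] : Fin 3 → ℕ) dbar y hy (sigmaAway σ hσh) hσJ hp hσpL hσy) ((algebraMap (MvPolynomial (Option (Fin 4)) k) (Localization.Away (cobordantAlgebra.subst k (![3, 1, 2, 0] : Fin 4 → ℕ) hh * (∏ l : ZMod p, (X (some 1) + (l.val : (MvPolynomial (Option (Fin 4)) k)) * (X none ^ 2 * X (some 0)))) ^ n₁))) (cobordantAlgebra.subst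 k (![3, 1, 2, 0] : Fin 4 → ℕ) hh)) = (algebraMap (MvPolynomial (Option (Fin 4)) k) (Localization.Away (cobordantAlgebra.subst k (![3, 1, 2, 0] : Fin 4 → ℕ) hh * (∏ l : ZMod p, (X (some 1) + (l.val : (MvPolynomial (Option (Fin 4)) k)) * (X none ^ 2 * X (some 0)))) ^ n₁))) (cobordantAlgebra.subst k (![3, 1, 2, 0] : Fin 4 → ℕ) hh) :=
    KillCert.QhAway.qhc_row_subst σ (![3, 1, 2] : Fin 3 → ℕ) hh hσh hp hσpL hσJ mo 𝒜 y hy hσy Φ hΦa hh hσh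
  have hZP1fix := KillCert.QhAway.qhc_normX1_fixed σ hC h0 h1 h2 (X 2 ^ 2 + 2 * X 1 * X 2 + C (2 * c) * X 2 + C (1 - 3 * a) * X 1 ^ 2 - X 1 ^ 3 : MvPolynomial (Fin 4) k) h3 (![3, 1, 2] : Fin 3 → ℕ) 2 hw0 hh hσh hp hσpL hσJ mo 𝒜 y hy hσy Φ hΦa hΦs hΦu hp1
  have hNHfix := KillCert.QhAway.qhc_normHQ_fixed σ hC h0 h1 h2 (X 2 ^ 2 + 2 * X 1 * X 2 + C (2 * c) * X 2 + C (1 - 3 * a) * X 1 ^ 2 - X 1 ^ 3 : MvPolynomial (Fin 4) k) h3 (![3, 1, 2] : Fin 3 → ℕ) 2 hw0 hh hσh hp hσpL hσJ mo 𝒜 y hy hσy Φ hΦa hΦs hΦu hp1 (2 * (1 - 3 * a))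
  have hτq : conj Φ (sigmaChart 𝒜 (fun i => algebraMap (MvPolynomial (Fin 4) k) (Localization.Away hh) (X ((![0, 1, 2] : Fin 3 → Fin 4) i))) (![3, 1, 2] : Fin 3 → ℕ) dbar y hy (sigmaAway σ hσh) hσJ hp hσpL hσy) ((algebraMap (MvPolynomial (Option (Fin 4)) k) (Localization.Away (cobordantAlgebra.subst k (![3, 1, 2, 0] : Fin 4 → ℕ) hh * (∏ l : ZMod p, (X (some 1) + (l.val : (MvPolynomial (Option (Fin 4)) k)) * (X none ^ 2 * X (some 0)))) ^ n₁))) ((cobordantAlgebra.subst k (![3, 1, 2, 0] : Fin 4 → ℕ) hh * (∏ l : ZMod p, (X (some 1) + (l.val : (MvPolynomial (Option (Fin 4)) k)) * (X none ^ 2 * X (some 0)))) ^ n₁) * ((∏ l : ZMod p, (C (2 * (1 - 3 * a)) * (X (some 1) + (l.val : (MvPolynomial (Option (Fin 4)) k)) * (X none ^ 2 * X (some 0))) + 2 * X none * X (some 2) - 3 * X none * (X (some 1) + (l.val : (MvPolynomial (Option (Fin 4)) k)) * (X none ^ 2 * X (some 0))) ^ 2)) ^ dbar))) = (algebraMap (MvPolynomial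 (Option (Fin 4)) k) (Localization.Away (cobordantAlgebra.subst k (![3, 1, 2, 0] : Fin 4 → ℕ) hh * (∏ l : ZMod p, (X (some 1) + (l.val : (MvPolynomial (Option (Fin 4)) k)) * (X none ^ 2 * X (some 0)))) ^ n₁))) ((cobordantAlgebra.subst k (![3, 1, 2, 0] : Fin 4 → ℕ) hh * (∏ l : ZMod p, (X (some 1) + (l.val : (MvPolynomial (Option (Fin 4)) k)) * (X none ^ 2 * X (some 0)))) ^ n₁) * ((∏ l : ZMod p, (C (2 * (1 - 3 * a)) * (X (some 1) + (l.val : (MvPolynomial (Option (Fin 4)) k)) * (X none ^ 2 * X (some 0))) + 2 * X none * X (some 2) - 3 * X none * (X (some 1) + (l.val : (MvPolynomial (Option (Fin 4)) k)) * (X none ^ 2 * X (some 0))) ^ 2)) ^ dbar)) := by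
    simp only [map_mul (algebraMap (MvPolynomial (Option (Fin 4)) k) (Localization.Away (cobordantAlgebra.subst k (![3, 1, 2, 0] : Fin 4 → ℕ) hh * (∏ l : ZMod p, (X (some 1) + (l.val : (MvPolynomial (Option (Fin 4)) k)) * (X none ^ 2 * X (some 0)))) ^ n₁))), map_pow (algebraMap (MvPolynomial (Option (Fin 4)) k) (Localization.Away (cobordantAlgebra.subst k (![3, 1, 2, 0] : Fin 4 → ℕ) hh * (∏ l : ZMod p, (X (some 1) + (l.val : (MvPolynomial (Option (Fin 4)) k)) * (X none ^ 2 * X (some 0)))) ^ n₁))), map_mul (conj Φ (sigmaChart 𝒜 (fun i => algebraMap (MvPolynomial (Fin 4) k) (Localization.Away hh) (X ((![0, 1, 2] : Fin 3 → Fin 4) i))) (![3, 1, 2] : Fin 3 → ℕ) dbar y hy (sigmaAway σ hσh) hσJ hp hσpL hσy)), map_pow (conj Φ (sigmaChart 𝒜 (fun i => algebraMap (MvPolynomial (Fin 4) k) (Localization.Away hh) (X ((![0, 1, 2] : Fin 3 → Fin 4) i))) (![3, 1, 2] : Fin 3 → ℕ) dbar y hy (sigmaAway σ hσh) hσJ hp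 hσpL hσy)), hrs, hZP1fix, hNHfix]
  -- ### `Z = N_R(ĥ_Q)`: fixed, bihomogeneous of bidegree `(p, 0)`, with polynomial image `NHQ`
  have hσ𝒜 : ∀ (i : Π j : Fin mg, ZMod (mo j)) (x : (Localization.Away hh)), x ∈ 𝒜 i → (sigmaAway σ hσh) x ∈ 𝒜 i := fun i x _ => hfull i _
  have hZfix : (sigmaR (sigmaAway σ hσh) (fun i => algebraMap (MvPolynomial (Fin 4) k) (Localization.Away hh) (X ((![0, 1, 2] : Fin 3 → Fin 4) i))) (![3, 1, 2] : Fin 3 → ℕ) hσJ hp hσpL) (∏ j : ZMod p, (⇑(sigmaR (sigmaAway σ hσh) (fun i => algebraMap (MvPolynomial (Fin 4) k) (Localization.Away hh) (X ((![0, 1, 2] : Fin 3 → Fin 4) i))) (![3, 1, 2] : Fin 3 → ℕ) hσJ hp hσpL))^[j.val] ((algebraMap (Localization.Away hh) ↥(cobordantAlgebra (fun i => algebraMap (MvPolynomial (Fin 4) k) (Localization.Away hh) (X ((![0, 1, 2] : Fin 3 → Fin 4) i))) (![3, 1, 2] : Fin 3 → ℕ)) (algebraMap (MvPolynomial (Fin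 4) k) (Localization.Away hh) (C (2 * (1 - 3 * a))))) * (cobordantAlgebra.u' (fun i => algebraMap (MvPolynomial (Fin 4) k) (Localization.Away hh) (X ((![0, 1, 2] : Fin 3 → Fin 4) i))) (![3, 1, 2] : Fin 3 → ℕ) 1) + 2 * (cobordantAlgebra.s (fun i => algebraMap (MvPolynomial (Fin 4) k) (Localization.Away hh) (X ((![0, 1, 2] : Fin 3 → Fin 4) i))) (![3, 1, 2] : Fin 3 → ℕ)) * (cobordantAlgebra.u' (fun i => algebraMap (MvPolynomial (Fin 4) k) (Localization.Away hh) (X ((![0, 1, 2] : Fin 3 → Fin 4) i))) (![3, 1, 2] : Fin 3 → ℕ) 2) - 3 * (cobordantAlgebra.s (fun i => algebraMap (MvPolynomial (Fin 4) k) (Localization.Away hh) (X ((![0, 1, 2] : Fin 3 → Fin 4) i))) (![3, 1, 2] : Fin 3 → ℕ)) * (cobordantAlgebra.u' (fun i => algebraMap (MvPolynomial (Fin 4) k) (Localization.Away hh) (X ((![0, 1, 2] : Fin 3 → Fin 4) i))) (![3, 1, 2] : Fin 3 → ℕ) 1) ^ 2 : ↥(cobordantAlgebra (fun i => algebraMap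 (MvPolynomial (Fin 4) k) (Localization.Away hh) (X ((![0, 1, 2] : Fin 3 → Fin 4) i))) (![3, 1, 2] : Fin 3 → ℕ)))) = (∏ j : ZMod p, (⇑(sigmaR (sigmaAway σ hσh) (fun i => algebraMap (MvPolynomial (Fin 4) k) (Localization.Away hh) (X ((![0, 1, 2] : Fin 3 → Fin 4) i))) (![3, 1, 2] : Fin 3 → ℕ) hσJ hp hσpL))^[j.val] ((algebraMap (Localization.Away hh) ↥(cobordantAlgebra (fun i => algebraMap (MvPolynomial (Fin 4) k) (Localization.Away hh) (X ((![0, 1, 2] : Fin 3 → Fin 4) i))) (![3, 1, 2] : Fin 3 → ℕ)) (algebraMap (MvPolynomial (Fin 4) k) (Localization.Away hh) (C (2 * (1 - 3 * a))))) * (cobordantAlgebra.u' (fun i => algebraMap (MvPolynomial (Fin 4) k) (Localization.Away hh) (X ((![0, 1, 2] : Fin 3 → Fin 4) i))) (![3, 1, 2] : Fin 3 → ℕ) 1) + 2 * (cobordantAlgebra.s (fun i => algebraMap (MvPolynomial (Fin 4) k) (Localization.Away hh) (X ((![0, 1, 2] : Fin 3 → Fin 4) i))) (![3, 1, 2] :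 Fin 3 → ℕ)) * (cobordantAlgebra.u' (fun i => algebraMap (MvPolynomial (Fin 4) k) (Localization.Away hh) (X ((![0, 1, 2] : Fin 3 → Fin 4) i))) (![3, 1, 2] : Fin 3 → ℕ) 2) - 3 * (cobordantAlgebra.s (fun i => algebraMap (MvPolynomial (Fin 4) k) (Localization.Away hh) (X ((![0, 1, 2] : Fin 3 → Fin 4) i))) (![3, 1, 2] : Fin 3 → ℕ)) * (cobordantAlgebra.u' (fun i => algebraMap (MvPolynomial (Fin 4) k) (Localization.Away hh) (X ((![0, 1, 2] : Fin 3 → Fin 4) i))) (![3, 1, 2] : Fin 3 → ℕ) 1) ^ 2 : ↥(cobordantAlgebra (fun i => algebraMap (MvPolynomial (Fin 4) k) (Localization.Away hh) (X ((![0, 1, 2] : Fin 3 → Fin 4) i))) (![3, 1, 2] : Fin 3 → ℕ)))) := KillCert.QhSym.sigmaR_normR_fixed (sigmaAway σ hσh) (fun i => algebraMap (MvPolynomial (Fin 4) k) (Localization.Away hh) (X ((![0, 1, 2] : Fin 3 → Fin 4) i))) (![3, 1, 2] : Fin 3 → ℕ) hp hσpL hσJ ((algebraMap (Localization.Away hh)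 ↥(cobordantAlgebra (fun i => algebraMap (MvPolynomial (Fin 4) k) (Localization.Away hh) (X ((![0, 1, 2] : Fin 3 → Fin 4) i))) (![3, 1, 2] : Fin 3 → ℕ)) (algebraMap (MvPolynomial (Fin 4) k) (Localization.Away hh) (C (2 * (1 - 3 * a))))) * (cobordantAlgebra.u' (fun i => algebraMap (MvPolynomial (Fin 4) k) (Localization.Away hh) (X ((![0, 1, 2] : Fin 3 → Fin 4) i))) (![3, 1, 2] : Fin 3 → ℕ) 1) + 2 * (cobordantAlgebra.s (fun i => algebraMap (MvPolynomial (Fin 4) k) (Localization.Away hh) (X ((![0, 1, 2] : Fin 3 → Fin 4) i))) (![3, 1, 2] : Fin 3 → ℕ)) * (cobordantAlgebra.u' (fun i => algebraMap (MvPolynomial (Fin 4) k) (Localization.Away hh) (X ((![0, 1, 2] : Fin 3 → Fin 4) i))) (![3, 1, 2] : Fin 3 → ℕ) 2) - 3 * (cobordantAlgebra.s (fun i => algebraMap (MvPolynomial (Fin 4) k) (Localization.Away hh) (X ((![0, 1, 2] : Fin 3 → Fin 4) i))) (![3, 1, 2] : Fin 3 → ℕ)) * (cobordantAlgebra.u'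 (fun i => algebraMap (MvPolynomial (Fin 4) k) (Localization.Away hh) (X ((![0, 1, 2] : Fin 3 → Fin 4) i))) (![3, 1, 2] : Fin 3 → ℕ) 1) ^ 2 : ↥(cobordantAlgebra (fun i => algebraMap (MvPolynomial (Fin 4) k) (Localization.Away hh) (X ((![0, 1, 2] : Fin 3 → Fin 4) i))) (![3, 1, 2] : Fin 3 → ℕ)))
  have hHHdeg : ((algebraMap (Localization.Away hh) ↥(cobordantAlgebra (fun i => algebraMap (MvPolynomial (Fin 4) k) (Localization.Away hh) (X ((![0, 1, 2] : Fin 3 → Fin 4) i))) (![3, 1, 2] : Fin 3 → ℕ)) (algebraMap (MvPolynomial (Fin 4) k) (Localization.Away hh) (C (2 * (1 - 3 * a))))) * (cobordantAlgebra.u' (fun i => algebraMap (MvPolynomial (Fin 4) k) (Localization.Away hh) (X ((![0, 1, 2] : Fin 3 → Fin 4) i))) (![3, 1, 2] : Fin 3 → ℕ) 1) + 2 * (cobordantAlgebra.s (fun i => algebraMap (MvPolynomial (Fin 4) k) (Localization.Away hh) (X ((![0, 1, 2] : Fin 3 → Fin 4) i))) (![3, 1, 2] : Fin 3 → ℕ))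 * (cobordantAlgebra.u' (fun i => algebraMap (MvPolynomial (Fin 4) k) (Localization.Away hh) (X ((![0, 1, 2] : Fin 3 → Fin 4) i))) (![3, 1, 2] : Fin 3 → ℕ) 2) - 3 * (cobordantAlgebra.s (fun i => algebraMap (MvPolynomial (Fin 4) k) (Localization.Away hh) (X ((![0, 1, 2] : Fin 3 → Fin 4) i))) (![3, 1, 2] : Fin 3 → ℕ)) * (cobordantAlgebra.u' (fun i => algebraMap (MvPolynomial (Fin 4) k) (Localization.Away hh) (X ((![0, 1, 2] : Fin 3 → Fin 4) i))) (![3, 1, 2] : Fin 3 → ℕ) 1) ^ 2 : ↥(cobordantAlgebra (fun i => algebraMap (MvPolynomial (Fin 4) k) (Localization.Away hh) (X ((![0, 1, 2] : Fin 3 → Fin 4) i))) (![3, 1, 2] : Fin 3 → ℕ))) ∈ reesPiece 𝒜 (fun i => algebraMap (MvPolynomial (Fin 4) k) (Localization.Away hh) (X ((![0, 1, 2] : Fin 3 → Fin 4) i))) (![3, 1, 2] : Fin 3 → ℕ) ((((1 : ℕ)) : ℤ), (0 : Π j : Fin mg, ZMod (mo j))) := KillCert.QhAway.hHatQ_mem_reesPiece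 (![3, 1, 2] : Fin 3 → ℕ) hh mo 𝒜 hf (fun x => hfull 0 x) (2 * (1 - 3 * a)) rfl rfl
  have hZdeg : (∏ j : ZMod p, (⇑(sigmaR (sigmaAway σ hσh) (fun i => algebraMap (MvPolynomial (Fin 4) k) (Localization.Away hh) (X ((![0, 1, 2] : Fin 3 → Fin 4) i))) (![3, 1, 2] : Fin 3 → ℕ) hσJ hp hσpL))^[j.val] ((algebraMap (Localization.Away hh) ↥(cobordantAlgebra (fun i => algebraMap (MvPolynomial (Fin 4) k) (Localization.Away hh) (X ((![0, 1, 2] : Fin 3 → Fin 4) i))) (![3, 1, 2] : Fin 3 → ℕ)) (algebraMap (MvPolynomial (Fin 4) k) (Localization.Away hh) (C (2 * (1 - 3 * a))))) * (cobordantAlgebra.u' (fun i => algebraMap (MvPolynomial (Fin 4) k) (Localization.Away hh) (X ((![0, 1, 2] : Fin 3 → Fin 4) i))) (![3, 1, 2] : Fin 3 → ℕ) 1) + 2 * (cobordantAlgebra.s (fun i => algebraMap (MvPolynomial (Fin 4) k) (Localization.Away hh) (X ((![0, 1, 2] : Fin 3 → Fin 4) i))) (![3, 1, 2] : Fin 3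 → ℕ)) * (cobordantAlgebra.u' (fun i => algebraMap (MvPolynomial (Fin 4) k) (Localization.Away hh) (X ((![0, 1, 2] : Fin 3 → Fin 4) i))) (![3, 1, 2] : Fin 3 → ℕ) 2) - 3 * (cobordantAlgebra.s (fun i => algebraMap (MvPolynomial (Fin 4) k) (Localization.Away hh) (X ((![0, 1, 2] : Fin 3 → Fin 4) i))) (![3, 1, 2] : Fin 3 → ℕ)) * (cobordantAlgebra.u' (fun i => algebraMap (MvPolynomial (Fin 4) k) (Localization.Away hh) (X ((![0, 1, 2] : Fin 3 → Fin 4) i))) (![3, 1, 2] : Fin 3 → ℕ) 1) ^ 2 : ↥(cobordantAlgebra (fun i => algebraMap (MvPolynomial (Fin 4) k) (Localization.Away hh) (X ((![0, 1, 2] : Fin 3 → Fin 4) i))) (![3, 1, 2] : Fin 3 → ℕ)))) ∈ reesPiece 𝒜 (fun i => algebraMap (MvPolynomial (Fin 4) k) (Localization.Away hh) (X ((![0, 1, 2] : Fin 3 → Fin 4) i))) (![3, 1, 2] : Fin 3 → ℕ) ((((1 * p : ℕ)) : ℤ), (0 : Π j : Fin mg, ZMod (mo j))) := KillCert.QhSym.normR_mem_reesPiece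 (sigmaAway σ hσh) (fun i => algebraMap (MvPolynomial (Fin 4) k) (Localization.Away hh) (X ((![0, 1, 2] : Fin 3 → Fin 4) i))) (![3, 1, 2] : Fin 3 → ℕ) hp hσpL hσJ mo 𝒜 hσ𝒜 hf hHHdeg
  have hb0 := FreeModel.bHat_mem_chartNodeGrading_zero mo 𝒜 (fun i => algebraMap (MvPolynomial (Fin 4) k) (Localization.Away hh) (X ((![0, 1, 2] : Fin 3 → Fin 4) i))) (![3, 1, 2] : Fin 3 → ℕ) hf dbar y hy (∏ j : ZMod p, (⇑(sigmaR (sigmaAway σ hσh) (fun i => algebraMap (MvPolynomial (Fin 4) k) (Localization.Away hh) (X ((![0, 1, 2] : Fin 3 → Fin 4) i))) (![3, 1, 2] : Fin 3 → ℕ) hσJ hp hσpL))^[j.val] ((algebraMap (Localization.Away hh) ↥(cobordantAlgebra (fun i => algebraMap (MvPolynomial (Fin 4) k) (Localization.Away hh) (X ((![0, 1, 2] : Fin 3 → Fin 4) i))) (![3, 1, 2] : Fin 3 → ℕ)) (algebraMap (MvPolynomial (Fin 4) k) (Localization.Away hh) (C (2 * (1 - 3 * a))))) * (cobordantAlgebra.u'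 (fun i => algebraMap (MvPolynomial (Fin 4) k) (Localization.Away hh) (X ((![0, 1, 2] : Fin 3 → Fin 4) i))) (![3, 1, 2] : Fin 3 → ℕ) 1) + 2 * (cobordantAlgebra.s (fun i => algebraMap (MvPolynomial (Fin 4) k) (Localization.Away hh) (X ((![0, 1, 2] : Fin 3 → Fin 4) i))) (![3, 1, 2] : Fin 3 → ℕ)) * (cobordantAlgebra.u' (fun i => algebraMap (MvPolynomial (Fin 4) k) (Localization.Away hh) (X ((![0, 1, 2] : Fin 3 → Fin 4) i))) (![3, 1, 2] : Fin 3 → ℕ) 2) - 3 * (cobordantAlgebra.s (fun i => algebraMap (MvPolynomial (Fin 4) k) (Localization.Away hh) (X ((![0, 1, 2] : Fin 3 → Fin 4) i))) (![3, 1, 2] : Fin 3 → ℕ)) * (cobordantAlgebra.u' (fun i => algebraMap (MvPolynomial (Fin 4) k) (Localization.Away hh) (X ((![0, 1, 2] : Fin 3 → Fin 4) i))) (![3, 1, 2] : Fin 3 → ℕ) 1) ^ 2 : ↥(cobordantAlgebra (fun i => algebraMap (MvPolynomial (Fin 4) k) (Localization.Away hh) (X ((![0, 1, 2] : Fin 3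 → Fin 4) i))) (![3, 1, 2] : Fin 3 → ℕ)))) (1 * p) hZdeg
  have hσbH := FreeModel.sigmaChart_bHat mo 𝒜 (fun i => algebraMap (MvPolynomial (Fin 4) k) (Localization.Away hh) (X ((![0, 1, 2] : Fin 3 → Fin 4) i))) (![3, 1, 2] : Fin 3 → ℕ) dbar y hy (∏ j : ZMod p, (⇑(sigmaR (sigmaAway σ hσh) (fun i => algebraMap (MvPolynomial (Fin 4) k) (Localization.Away hh) (X ((![0, 1, 2] : Fin 3 → Fin 4) i))) (![3, 1, 2] : Fin 3 → ℕ) hσJ hp hσpL))^[j.val] ((algebraMap (Localization.Away hh) ↥(cobordantAlgebra (fun i => algebraMap (MvPolynomial (Fin 4) k) (Localization.Away hh) (X ((![0, 1, 2] : Fin 3 → Fin 4) i))) (![3, 1, 2] : Fin 3 → ℕ)) (algebraMap (MvPolynomial (Fin 4) k) (Localization.Away hh) (C (2 * (1 - 3 * a))))) * (cobordantAlgebra.u' (fun i => algebraMap (MvPolynomial (Fin 4) k) (Localization.Away hh) (X ((![0, 1, 2] : Fin 3 → Fin 4) i))) (![3, 1, 2] : Fin 3 → ℕ) 1) + 2 *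 (cobordantAlgebra.s (fun i => algebraMap (MvPolynomial (Fin 4) k) (Localization.Away hh) (X ((![0, 1, 2] : Fin 3 → Fin 4) i))) (![3, 1, 2] : Fin 3 → ℕ)) * (cobordantAlgebra.u' (fun i => algebraMap (MvPolynomial (Fin 4) k) (Localization.Away hh) (X ((![0, 1, 2] : Fin 3 → Fin 4) i))) (![3, 1, 2] : Fin 3 → ℕ) 2) - 3 * (cobordantAlgebra.s (fun i => algebraMap (MvPolynomial (Fin 4) k) (Localization.Away hh) (X ((![0, 1, 2] : Fin 3 → Fin 4) i))) (![3, 1, 2] : Fin 3 → ℕ)) * (cobordantAlgebra.u' (fun i => algebraMap (MvPolynomial (Fin 4) k) (Localization.Away hh) (X ((![0, 1, 2] : Fin 3 → Fin 4) i))) (![3, 1, 2] : Fin 3 → ℕ) 1) ^ 2 : ↥(cobordantAlgebra (fun i => algebraMap (MvPolynomial (Fin 4) k) (Localization.Away hh) (X ((![0, 1, 2] : Fin 3 → Fin 4) i))) (![3, 1, 2] : Fin 3 → ℕ)))) (1 * p) (sigmaAway σ hσh) hσJ hp hσpL hσy hZfix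
  have hΦZ : Φ ((algebraMap ↥(cobordantAlgebra (fun i => algebraMap (MvPolynomial (Fin 4) k) (Localization.Away hh) (X ((![0, 1, 2] : Fin 3 → Fin 4) i))) (![3, 1, 2] : Fin 3 → ℕ)) (ChartRing 𝒜 (fun i => algebraMap (MvPolynomial (Fin 4) k) (Localization.Away hh) (X ((![0, 1, 2] : Fin 3 → Fin 4) i))) (![3, 1, 2] : Fin 3 → ℕ) dbar y hy)) (∏ j : ZMod p, (⇑(sigmaR (sigmaAway σ hσh) (fun i => algebraMap (MvPolynomial (Fin 4) k) (Localization.Away hh) (X ((![0, 1, 2] : Fin 3 → Fin 4) i))) (![3, 1, 2] : Fin 3 → ℕ) hσJ hp hσpL))^[j.val] ((algebraMap (Localization.Away hh) ↥(cobordantAlgebra (fun i => algebraMap (MvPolynomial (Fin 4) k) (Localization.Away hh) (X ((![0, 1, 2] : Fin 3 → Fin 4) i))) (![3, 1, 2] : Fin 3 → ℕ)) (algebraMap (MvPolynomial (Fin 4) k) (Localization.Away hh) (C (2 * (1 - 3 * a))))) * (cobordantAlgebra.u' (fun i => algebraMap (MvPolynomial (Fin 4) k) (Localization.Away hh) (X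 ((![0, 1, 2] : Fin 3 → Fin 4) i))) (![3, 1, 2] : Fin 3 → ℕ) 1) + 2 * (cobordantAlgebra.s (fun i => algebraMap (MvPolynomial (Fin 4) k) (Localization.Away hh) (X ((![0, 1, 2] : Fin 3 → Fin 4) i))) (![3, 1, 2] : Fin 3 → ℕ)) * (cobordantAlgebra.u' (fun i => algebraMap (MvPolynomial (Fin 4) k) (Localization.Away hh) (X ((![0, 1, 2] : Fin 3 → Fin 4) i))) (![3, 1, 2] : Fin 3 → ℕ) 2) - 3 * (cobordantAlgebra.s (fun i => algebraMap (MvPolynomial (Fin 4) k) (Localization.Away hh) (X ((![0, 1, 2] : Fin 3 → Fin 4) i))) (![3, 1, 2] : Fin 3 → ℕ)) * (cobordantAlgebra.u' (fun i => algebraMap (MvPolynomial (Fin 4) k) (Localization.Away hh) (X ((![0, 1, 2] : Fin 3 → Fin 4) i))) (![3, 1, 2] : Fin 3 → ℕ) 1) ^ 2 : ↥(cobordantAlgebra (fun i => algebraMap (MvPolynomial (Fin 4) k) (Localization.Away hh) (X ((![0, 1, 2] : Fin 3 → Fin 4) i))) (![3, 1, 2] : Fin 3 → ℕ))))) = (algebraMap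 (MvPolynomial (Option (Fin 4)) k) (Localization.Away (cobordantAlgebra.subst k (![3, 1, 2, 0] : Fin 4 → ℕ) hh * (∏ l : ZMod p, (X (some 1) + (l.val : (MvPolynomial (Option (Fin 4)) k)) * (X none ^ 2 * X (some 0)))) ^ n₁))) (∏ l : ZMod p, (C (2 * (1 - 3 * a)) * (X (some 1) + (l.val : (MvPolynomial (Option (Fin 4)) k)) * (X none ^ 2 * X (some 0))) + 2 * X none * X (some 2) - 3 * X none * (X (some 1) + (l.val : (MvPolynomial (Option (Fin 4)) k)) * (X none ^ 2 * X (some 0))) ^ 2)) :=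
    KillCert.QhAway.qhc_map_normR_hHatQ σ hC h0 h1 h2 (X 2 ^ 2 + 2 * X 1 * X 2 + C (2 * c) * X 2 + C (1 - 3 * a) * X 1 ^ 2 - X 1 ^ 3 : MvPolynomial (Fin 4) k) h3 (![3, 1, 2] : Fin 3 → ℕ) 2 hw0 hh hσh hp hσpL hσJ mo 𝒜 y hy hσy Φ hΦa hΦs hΦu (2 * (1 - 3 * a))
  -- the section `b` with chart value `b̂`
  obtain ⟨b, hb⟩ : ∃ b : Γ(M.V, W.1), b = E.symm ⟨_, hb0⟩ := ⟨_, rfl⟩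
  have hEb : ((E b : ↥((chartNodeGrading mo 𝒜 (fun i => algebraMap (MvPolynomial (Fin 4) k) (Localization.Away hh) (X ((![0, 1, 2] : Fin 3 → Fin 4) i))) (![3, 1, 2] : Fin 3 → ℕ) hf dbar y hy) 0)) : (ChartRing 𝒜 (fun i => algebraMap (MvPolynomial (Fin 4) k) (Localization.Away hh) (X ((![0, 1, 2] : Fin 3 → Fin 4) i))) (![3, 1, 2] : Fin 3 → ℕ) dbar y hy)) = (algebraMap ↥(cobordantAlgebra (fun i => algebraMap (MvPolynomial (Fin 4) k) (Localization.Away hh) (X ((![0, 1, 2] : Fin 3 → Fin 4) i))) (![3, 1, 2] : Fin 3 → ℕ)) (ChartRing 𝒜 (fun i => algebraMap (MvPolynomial (Fin 4) k) (Localization.Away hh) (X ((![0, 1, 2] : Fin 3 → Fin 4) i))) (![3, 1, 2] : Fin 3 → ℕ) dbar y hy)) ((∏ j : ZMod p, (⇑(sigmaR (sigmaAway σ hσh) (fun i => algebraMap (MvPolynomial (Fin 4) k) (Localization.Away hh) (X ((![0, 1, 2] : Fin 3 → Fin 4) i))) (![3, 1, 2] : Fin 3 → ℕ) hσJ hp hσpL))^[j.val]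 ((algebraMap (Localization.Away hh) ↥(cobordantAlgebra (fun i => algebraMap (MvPolynomial (Fin 4) k) (Localization.Away hh) (X ((![0, 1, 2] : Fin 3 → Fin 4) i))) (![3, 1, 2] : Fin 3 → ℕ)) (algebraMap (MvPolynomial (Fin 4) k) (Localization.Away hh) (C (2 * (1 - 3 * a))))) * (cobordantAlgebra.u' (fun i => algebraMap (MvPolynomial (Fin 4) k) (Localization.Away hh) (X ((![0, 1, 2] : Fin 3 → Fin 4) i))) (![3, 1, 2] : Fin 3 → ℕ) 1) + 2 * (cobordantAlgebra.s (fun i => algebraMap (MvPolynomial (Fin 4) k) (Localization.Away hh) (X ((![0, 1, 2] : Fin 3 → Fin 4) i))) (![3, 1, 2] : Fin 3 → ℕ)) * (cobordantAlgebra.u' (fun i => algebraMap (MvPolynomial (Fin 4) k) (Localization.Away hh) (X ((![0, 1, 2] : Fin 3 → Fin 4) i))) (![3, 1, 2] : Fin 3 → ℕ) 2) - 3 * (cobordantAlgebra.s (fun i => algebraMap (MvPolynomial (Fin 4) k) (Localization.Away hh) (X ((![0, 1, 2] : Fin 3 → Fin 4) i))) (![3, 1, 2] : Fin 3 → ℕ))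 * (cobordantAlgebra.u' (fun i => algebraMap (MvPolynomial (Fin 4) k) (Localization.Away hh) (X ((![0, 1, 2] : Fin 3 → Fin 4) i))) (![3, 1, 2] : Fin 3 → ℕ) 1) ^ 2 : ↥(cobordantAlgebra (fun i => algebraMap (MvPolynomial (Fin 4) k) (Localization.Away hh) (X ((![0, 1, 2] : Fin 3 → Fin 4) i))) (![3, 1, 2] : Fin 3 → ℕ)))) ^ dbar) * IsLocalization.Away.invSelf (coverElement 𝒜 (fun i => algebraMap (MvPolynomial (Fin 4) k) (Localization.Away hh) (X ((![0, 1, 2] : Fin 3 → Fin 4) i))) (![3, 1, 2] : Fin 3 → ℕ) dbar y hy) ^ (1 * p) := by rw [hb, E.apply_symm_apply]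
  have hσbE : (sigmaChart 𝒜 (fun i => algebraMap (MvPolynomial (Fin 4) k) (Localization.Away hh) (X ((![0, 1, 2] : Fin 3 → Fin 4) i))) (![3, 1, 2] : Fin 3 → ℕ) dbar y hy (sigmaAway σ hσh) hσJ hp hσpL hσy) ((E b : ↥((chartNodeGrading mo 𝒜 (fun i => algebraMap (MvPolynomial (Fin 4) k) (Localization.Away hh) (X ((![0, 1, 2] : Fin 3 → Fin 4) i))) (![3, 1, 2] : Fin 3 → ℕ) hf dbar y hy) 0)) : (ChartRing 𝒜 (fun i => algebraMap (MvPolynomial (Fin 4) k) (Localization.Away hh) (X ((![0, 1, 2] : Fin 3 → Fin 4) i))) (![3, 1, 2] : Fin 3 → ℕ) dbar y hy)) = ((E b : ↥((chartNodeGrading mo 𝒜 (fun i => algebraMap (MvPolynomial (Fin 4) k) (Localization.Away hh) (X ((![0, 1, 2] : Fin 3 → Fin 4) i))) (![3, 1, 2] : Fin 3 → ℕ) hf dbar y hy) 0)) : (ChartRing 𝒜 (fun i => algebraMap (MvPolynomial (Fin 4) k) (Localization.Away hh) (X ((![0, 1, 2] : Fin 3 → Fin 4) i))) (![3, 1, 2]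 : Fin 3 → ℕ) dbar y hy)) := by rw [hEb]; exact hσbH
  have hΦb : Associated (Φ ((E b : ↥((chartNodeGrading mo 𝒜 (fun i => algebraMap (MvPolynomial (Fin 4) k) (Localization.Away hh) (X ((![0, 1, 2] : Fin 3 → Fin 4) i))) (![3, 1, 2] : Fin 3 → ℕ) hf dbar y hy) 0)) : (ChartRing 𝒜 (fun i => algebraMap (MvPolynomial (Fin 4) k) (Localization.Away hh) (X ((![0, 1, 2] : Fin 3 → Fin 4) i))) (![3, 1, 2] : Fin 3 → ℕ) dbar y hy))) ((algebraMap (MvPolynomial (Option (Fin 4)) k) (Localization.Away (cobordantAlgebra.subst k (![3, 1, 2, 0] : Fin 4 → ℕ) hh * (∏ l : ZMod p, (X (some 1) + (l.val : (MvPolynomial (Option (Fin 4)) k)) * (X none ^ 2 * X (some 0)))) ^ n₁))) ((∏ l : ZMod p, (C (2 * (1 - 3 * a)) * (X (some 1) + (l.val : (MvPolynomial (Option (Fin 4)) k)) * (X none ^ 2 * X (some 0))) + 2 * X none * X (some 2) - 3 * X none * (X (some 1) + (l.val : (MvPolynomial (Option (Fin 4)) k)) * (X none ^ 2 * X (some 0)))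 ^ 2)) ^ dbar)) := by
    rw [hEb, map_pow ((algebraMap (MvPolynomial (Option (Fin 4)) k) (Localization.Away (cobordantAlgebra.subst k (![3, 1, 2, 0] : Fin 4 → ℕ) hh * (∏ l : ZMod p, (X (some 1) + (l.val : (MvPolynomial (Option (Fin 4)) k)) * (X none ^ 2 * X (some 0)))) ^ n₁))))]
    exact FreeModel.associated_map_bHat mo 𝒜 (fun i => algebraMap (MvPolynomial (Fin 4) k) (Localization.Away hh) (X ((![0, 1, 2] : Fin 3 → Fin 4) i))) (![3, 1, 2] : Fin 3 → ℕ) dbar y hy (∏ j : ZMod p, (⇑(sigmaR (sigmaAway σ hσh) (fun i => algebraMap (MvPolynomial (Fin 4) k) (Localization.Away hh) (X ((![0, 1, 2] : Fin 3 → Fin 4) i))) (![3, 1, 2] : Fin 3 → ℕ) hσJ hp hσpL))^[j.val] ((algebraMap (Localization.Away hh) ↥(cobordantAlgebra (fun i => algebraMap (MvPolynomial (Fin 4) k) (Localization.Away hh) (X ((![0, 1, 2] : Fin 3 → Fin 4) i))) (![3, 1, 2] : Fin 3 → ℕ)) (algebraMap (MvPolynomial (Fin 4) k) (Localization.Away hh)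 (C (2 * (1 - 3 * a))))) * (cobordantAlgebra.u' (fun i => algebraMap (MvPolynomial (Fin 4) k) (Localization.Away hh) (X ((![0, 1, 2] : Fin 3 → Fin 4) i))) (![3, 1, 2] : Fin 3 → ℕ) 1) + 2 * (cobordantAlgebra.s (fun i => algebraMap (MvPolynomial (Fin 4) k) (Localization.Away hh) (X ((![0, 1, 2] : Fin 3 → Fin 4) i))) (![3, 1, 2] : Fin 3 → ℕ)) * (cobordantAlgebra.u' (fun i => algebraMap (MvPolynomial (Fin 4) k) (Localization.Away hh) (X ((![0, 1, 2] : Fin 3 → Fin 4) i))) (![3, 1, 2] : Fin 3 → ℕ) 2) - 3 * (cobordantAlgebra.s (fun i => algebraMap (MvPolynomial (Fin 4) k) (Localization.Away hh) (X ((![0, 1, 2] : Fin 3 → Fin 4) i))) (![3, 1, 2] : Fin 3 → ℕ)) * (cobordantAlgebra.u' (fun i => algebraMap (MvPolynomial (Fin 4) k) (Localization.Away hh) (X ((![0, 1, 2] : Fin 3 → Fin 4) i))) (![3, 1, 2] : Fin 3 → ℕ) 1) ^ 2 : ↥(cobordantAlgebra (fun i => algebraMap (MvPolynomial (Fin 4)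 k) (Localization.Away hh) (X ((![0, 1, 2] : Fin 3 → Fin 4) i))) (![3, 1, 2] : Fin 3 → ℕ)))) (1 * p) Φ hΦZ
  obtain ⟨Φ', hpin, hpin2⟩ := FreeModel.exists_awayModelEquiv (cobordantAlgebra.subst k (![3, 1, 2, 0] : Fin 4 → ℕ) hh * (∏ l : ZMod p, (X (some 1) + (l.val : (MvPolynomial (Option (Fin 4)) k)) * (X none ^ 2 * X (some 0)))) ^ n₁) Φ ((E b : ↥((chartNodeGrading mo 𝒜 (fun i => algebraMap (MvPolynomial (Fin 4) k) (Localization.Away hh) (X ((![0, 1, 2] : Fin 3 → Fin 4) i))) (![3, 1, 2] : Fin 3 → ℕ) hf dbar y hy) 0)) : (ChartRing 𝒜 (fun i => algebraMap (MvPolynomial (Fin 4) k) (Localization.Away hh) (X ((![0, 1, 2] : Fin 3 → Fin 4) i))) (![3, 1, 2] : Fin 3 → ℕ) dbar y hy)) ((∏ l : ZMod p, (C (2 * (1 - 3 * a)) * (X (some 1) + (l.val : (MvPolynomial (Option (Fin 4)) k)) * (X none ^ 2 * X (some 0))) + 2 * X none * X (some 2) - 3 * X none * (X (some 1) + (l.val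 : (MvPolynomial (Option (Fin 4)) k)) * (X none ^ 2 * X (some 0))) ^ 2)) ^ dbar) hΦb
  -- ### K1′ of `(x′₀, T′)` on the localised model (Jacobian certificate `π^*x₂`, ✓`cuspQ_x₂_not_mem`)
  have hsubst_dvd : cobordantAlgebra.subst k (![3, 1, 2, 0] : Fin 4 → ℕ) hh ∣ (cobordantAlgebra.subst k (![3, 1, 2, 0] : Fin 4 → ℕ) hh * (∏ l : ZMod p, (X (some 1) + (l.val : (MvPolynomial (Option (Fin 4)) k)) * (X none ^ 2 * X (some 0)))) ^ n₁) * ((∏ l : ZMod p, (C (2 * (1 - 3 * a)) * (X (some 1) + (l.val : (MvPolynomial (Option (Fin 4)) k)) * (X none ^ 2 * X (some 0))) + 2 * X none * X (some 2) - 3 * X none * (X (some 1) + (l.val : (MvPolynomial (Option (Fin 4)) k)) * (X none ^ 2 * X (some 0))) ^ 2)) ^ dbar) := (dvd_mul_right _ _).trans (dvd_mul_right _ _)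
  have h2c' : (2 : (MvPolynomial (Option (Fin 4)) k)) * C c = 3 * C a ^ 2 := by
    have h := congrArg (C : k → (MvPolynomial (Option (Fin 4)) k)) hQ1; simp only [map_mul, map_pow, map_ofNat] at h; exact h
  have hc2' : (C c : (MvPolynomial (Option (Fin 4)) k)) ^ 2 = C a ^ 3 := by
    have h := congrArg (C : k → (MvPolynomial (Option (Fin 4)) k)) hQ2; simp only [map_pow] at h; exact h
  have hD : ∀ Q : Ideal (MvPolynomial (Option (Fin 4)) k), Q.IsPrime → (X (some 0) : (MvPolynomial (Option (Fin 4)) k)) ∈ Q →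
      (X none ^ 2 * X (some 2) ^ 2 + 2 * X none * X (some 2) * X (some 1) + C (2 * c) * X (some 2) + C (1 - 3 * a) * X (some 1) ^ 2 - X none * X (some 1) ^ 3 : (MvPolynomial (Option (Fin 4)) k)) ∈ Q →
      (cobordantAlgebra.subst k (![3, 1, 2, 0] : Fin 4 → ℕ) hh * (∏ l : ZMod p, (X (some 1) + (l.val : (MvPolynomial (Option (Fin 4)) k)) * (X none ^ 2 * X (some 0)))) ^ n₁) * ((∏ l : ZMod p, (C (2 * (1 - 3 * a)) * (X (some 1) + (l.val : (MvPolynomial (Option (Fin 4)) k)) * (X none ^ 2 * X (some 0))) + 2 * X none * X (some 2) - 3 * X none * (X (some 1) + (l.val : (MvPolynomial (Option (Fin 4)) k)) * (X none ^ 2 * X (some 0))) ^ 2)) ^ dbar) ∉ Q → (C c + X none * X (some 1) + X none ^ 2 * X (some 2) : (MvPolynomial (Option (Fin 4)) k)) ∉ Q := by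
    intro Q hQ hX0 hT hq
    have hH : (∏ l : ZMod p, (X none * X (some 1) + C a + ((l.val : (MvPolynomial (Option (Fin 4)) k)) * X none ^ 3) * X (some 0))) ∉ Q := by
      intro hmem
      refine hq ?_
      obtain ⟨c', hc'⟩ := hsubst_dvd
      rw [hc']
      refine Q.mul_mem_right _ ?_
      rw [hsubst_hh]
      have : (∏ l : ZMod p, (X none ^ 1 * X (some 1) + C a + (l.val : (MvPolynomial (Option (Fin 4)) k)) * (X none ^ 3 * X (some 0)))) =
          ∏ l : ZMod p, (X none * X (some 1) + C a + ((l.val : (MvPolynomial (Option (Fin 4)) k)) * X none ^ 3) * X (some 0)) := Finset.prod_congr rfl fun l _ => by ring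
      rw [this]; exact hmem
    have hT2 : X none ^ 2 * X (some 2) ^ 2 + 2 * X none * X (some 2) * X (some 1) + 2 * C c * X (some 2) + (1 - 3 * C a) * X (some 1) ^ 2 - X none * X (some 1) ^ 3 ∈ Q := by
      have : (X none ^ 2 * X (some 2) ^ 2 + 2 * X none * X (some 2) * X (some 1) + 2 * C c * X (some 2) + (1 - 3 * C a) * X (some 1) ^ 2 - X none * X (some 1) ^ 3 : (MvPolynomial (Option (Fin 4)) k)) =
          X none ^ 2 * X (some 2) ^ 2 + 2 * X none * X (some 2) * X (some 1) + C (2 * c) * X (some 2) + C (1 - 3 * a) * X (some 1) ^ 2 - X none * X (some 1) ^ 3 := by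
        simp only [map_mul, map_sub, map_one, map_ofNat]
      rw [this]; exact hT
    exact (Cusp.cuspQ_x₂_not_mem Q (X none) (X (some 0)) (X (some 1)) (X (some 2)) (C a) (C c) (fun l : ZMod p => (l.val : (MvPolynomial (Option (Fin 4)) k)) * X none ^ 3)
      (fun l : ZMod p => (l.val : (MvPolynomial (Option (Fin 4)) k)) * X none ^ 2) h2c' hc2' hX0 hT2 hH).1
  obtain ⟨hK1, hK1'⟩ := FreeModel.isRegular_away_X_cuspGraphQ' ((cobordantAlgebra.subst k (![3, 1, 2, 0] : Fin 4 → ℕ) hh * (∏ l : ZMod p, (X (some 1) + (l.val : (MvPolynomial (Option (Fin 4)) k)) * (X none ^ 2 * X (some 0)))) ^ n₁) * ((∏ l : ZMod p, (C (2 * (1 - 3 * a)) * (X (some 1) + (l.val : (MvPolynomial (Option (Fin 4)) k)) * (X none ^ 2 * X (some 0))) + 2 * X none * X (some 2) - 3 * X none * (X (some 1) + (l.val : (MvPolynomial (Option (Fin 4)) k)) * (X none ^ 2 * X (some 0))) ^ 2)) ^ dbar)) a c h2k hD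
    (fun o : Option (Fin 4) => o.elim (0 : k) ![0, 1, -(1 - 3 * a) / (2 * c), 0]) rfl
    (by
      change (0 : k) ^ 2 * ((![0, 1, -(1 - 3 * a) / (2 * c), 0] : Fin 4 → k) 2) ^ 2 + 2 * 0 * ((![0, 1, -(1 - 3 * a) / (2 * c), 0] : Fin 4 → k) 2) * ((![0, 1, -(1 - 3 * a) / (2 * c), 0] : Fin 4 → k) 1) +
        2 * c * ((![0, 1, -(1 - 3 * a) / (2 * c), 0] : Fin 4 → k) 2) + (1 - 3 * a) * ((![0, 1, -(1 - 3 * a) / (2 * c), 0] : Fin 4 → k) 1) ^ 2 -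
        0 * ((![0, 1, -(1 - 3 * a) / (2 * c), 0] : Fin 4 → k) 1) ^ 3 = 0
      simp only [Matrix.cons_val_zero, Matrix.cons_val_one, Matrix.cons_val_two, Matrix.head_cons, Matrix.tail_cons]
      field_simp
      ring) hupt
  -- ### units of the localised model
  have hHUdvd : (C (2 * (1 - 3 * a)) * X (some 1) + 2 * X none * X (some 2) - 3 * X none * X (some 1) ^ 2 : MvPolynomial (Option (Fin 4)) k) ∣ (cobordantAlgebra.subst k (![3, 1, 2, 0] : Fin 4 → ℕ) hh * (∏ l : ZMod p, (X (some 1) + (l.val : (MvPolynomial (Option (Fin 4)) k)) * (X none ^ 2 * X (some 0)))) ^ n₁) * ((∏ l : ZMod p, (C (2 * (1 - 3 * a)) * (X (some 1) + (l.val : (MvPolynomial (Option (Fin 4)) k)) * (X none ^ 2 * X (some 0))) + 2 * X none * X (some 2) - 3 * X none * (X (some 1) + (l.val : (MvPolynomial (Option (Fin 4)) k)) * (X none ^ 2 * X (some 0))) ^ 2)) ^ dbar) := by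
    have h := Finset.dvd_prod_of_mem (fun l : ZMod p => (C (2 * (1 - 3 * a)) * (X (some 1) + (l.val : (MvPolynomial (Option (Fin 4)) k)) * (X none ^ 2 * X (some 0))) + 2 * X none * X (some 2) -
      3 * X none * (X (some 1) + (l.val : (MvPolynomial (Option (Fin 4)) k)) * (X none ^ 2 * X (some 0))) ^ 2)) (Finset.mem_univ (0 : ZMod p))
    rw [ZMod.val_zero, Nat.cast_zero, zero_mul, add_zero] at h
    exact (h.trans (dvd_pow_self _ hdbar.ne')).trans (dvd_mul_left _ _)
  have hHU := FreeModel.isUnit_algebraMap_of_dvd_mul (cobordantAlgebra.subst k (![3, 1, 2, 0] : Fin 4 → ℕ) hh * (∏ l : ZMod p, (X (some 1) + (l.val : (MvPolynomial (Option (Fin 4)) k)) * (X none ^ 2 * X (some 0)))) ^ n₁) ((∏ l : ZMod p, (C (2 * (1 - 3 * a)) * (X (some 1) + (l.val : (MvPolynomial (Option (Fin 4)) k)) * (X none ^ 2 * X (some 0))) + 2 * X none * X (some 2) - 3 * X none * (X (some 1) + (l.val : (MvPolynomial (Option (Fin 4)) k)) * (X none ^ 2 * X (some 0))) ^ 2))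 ^ dbar) hHUdvd
  have hQ₁ : IsUnit (((algebraMap (MvPolynomial (Option (Fin 4)) k) (Localization.Away ((cobordantAlgebra.subst k (![3, 1, 2, 0] : Fin 4 → ℕ) hh * (∏ l : ZMod p, (X (some 1) + (l.val : (MvPolynomial (Option (Fin 4)) k)) * (X none ^ 2 * X (some 0)))) ^ n₁) * ((∏ l : ZMod p, (C (2 * (1 - 3 * a)) * (X (some 1) + (l.val : (MvPolynomial (Option (Fin 4)) k)) * (X none ^ 2 * X (some 0))) + 2 * X none * X (some 2) - 3 * X none * (X (some 1) + (l.val : (MvPolynomial (Option (Fin 4)) k)) * (X none ^ 2 * X (some 0))) ^ 2)) ^ dbar)))) : (MvPolynomial (Option (Fin 4)) k) →+* (Localization.Away ((cobordantAlgebra.subst k (![3, 1, 2, 0] : Fin 4 → ℕ) hh * (∏ l : ZMod p, (X (some 1) + (l.val : (MvPolynomial (Option (Fin 4)) k)) * (X none ^ 2 * X (some 0)))) ^ n₁) * ((∏ l : ZMod p, (C (2 * (1 - 3 * a)) * (X (some 1) + (l.val : (MvPolynomial (Option (Fin 4)) k)) * (X none ^ 2 * X (some 0))) + 2 * X none * X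 (some 2) - 3 * X none * (X (some 1) + (l.val : (MvPolynomial (Option (Fin 4)) k)) * (X none ^ 2 * X (some 0))) ^ 2)) ^ dbar)))) 1) := by rw [map_one]; exact isUnit_one
  -- ### generators
  have hgen : Subring.closure (({((algebraMap (MvPolynomial (Option (Fin 4)) k) (Localization.Away ((cobordantAlgebra.subst k (![3, 1, 2, 0] : Fin 4 → ℕ) hh * (∏ l : ZMod p, (X (some 1) + (l.val : (MvPolynomial (Option (Fin 4)) k)) * (X none ^ 2 * X (some 0)))) ^ n₁) * ((∏ l : ZMod p, (C (2 * (1 - 3 * a)) * (X (some 1) + (l.val : (MvPolynomial (Option (Fin 4)) k)) * (X none ^ 2 * X (some 0))) + 2 * X none * X (some 2) - 3 * X none * (X (some 1) + (l.val : (MvPolynomial (Option (Fin 4)) k)) * (X none ^ 2 * X (some 0))) ^ 2)) ^ dbar)))) : (MvPolynomial (Option (Fin 4)) k) →+* (Localization.Away ((cobordantAlgebra.subst k (![3, 1, 2, 0] : Fin 4 → ℕ) hh * (∏ l : ZMod p, (X (some 1) + (l.val : (MvPolynomial (Option (Fin 4)) k)) * (X none ^ 2 * X (some 0)))) ^ n₁)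 * ((∏ l : ZMod p, (C (2 * (1 - 3 * a)) * (X (some 1) + (l.val : (MvPolynomial (Option (Fin 4)) k)) * (X none ^ 2 * X (some 0))) + 2 * X none * X (some 2) - 3 * X none * (X (some 1) + (l.val : (MvPolynomial (Option (Fin 4)) k)) * (X none ^ 2 * X (some 0))) ^ 2)) ^ dbar)))) (X none), ((algebraMap (MvPolynomial (Option (Fin 4)) k) (Localization.Away ((cobordantAlgebra.subst k (![3, 1, 2, 0] : Fin 4 → ℕ) hh * (∏ l : ZMod p, (X (some 1) + (l.val : (MvPolynomial (Option (Fin 4)) k)) * (X none ^ 2 * X (some 0)))) ^ n₁) * ((∏ l : ZMod p, (C (2 * (1 - 3 * a)) * (X (some 1) + (l.val : (MvPolynomial (Option (Fin 4)) k)) * (X none ^ 2 * X (some 0))) + 2 * X none * X (some 2) - 3 * X none * (X (some 1) + (l.val : (MvPolynomial (Option (Fin 4)) k)) * (X none ^ 2 * X (some 0))) ^ 2)) ^ dbar)))) : (MvPolynomial (Option (Fin 4)) k) →+* (Localization.Away ((cobordantAlgebra.subst k (![3, 1, 2, 0] : Fin 4 → ℕ) hh * (∏ l : ZMod p, (X (some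 1) + (l.val : (MvPolynomial (Option (Fin 4)) k)) * (X none ^ 2 * X (some 0)))) ^ n₁) * ((∏ l : ZMod p, (C (2 * (1 - 3 * a)) * (X (some 1) + (l.val : (MvPolynomial (Option (Fin 4)) k)) * (X none ^ 2 * X (some 0))) + 2 * X none * X (some 2) - 3 * X none * (X (some 1) + (l.val : (MvPolynomial (Option (Fin 4)) k)) * (X none ^ 2 * X (some 0))) ^ 2)) ^ dbar)))) (X (some 0)), ((algebraMap (MvPolynomial (Option (Fin 4)) k) (Localization.Away ((cobordantAlgebra.subst k (![3, 1, 2, 0] : Fin 4 → ℕ) hh * (∏ l : ZMod p, (X (some 1) + (l.val : (MvPolynomial (Option (Fin 4)) k)) * (X none ^ 2 * X (some 0)))) ^ n₁) * ((∏ l : ZMod p, (C (2 * (1 - 3 * a)) * (X (some 1) + (l.val : (MvPolynomial (Option (Fin 4)) k)) * (X none ^ 2 * X (some 0))) + 2 * X none * X (some 2) - 3 * X none * (X (some 1) + (l.val : (MvPolynomial (Option (Fin 4)) k)) * (X none ^ 2 * X (some 0))) ^ 2)) ^ dbar)))) : (MvPolynomial (Option (Fin 4)) k) →+* (Localization.Away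 ((cobordantAlgebra.subst k (![3, 1, 2, 0] : Fin 4 → ℕ) hh * (∏ l : ZMod p, (X (some 1) + (l.val : (MvPolynomial (Option (Fin 4)) k)) * (X none ^ 2 * X (some 0)))) ^ n₁) * ((∏ l : ZMod p, (C (2 * (1 - 3 * a)) * (X (some 1) + (l.val : (MvPolynomial (Option (Fin 4)) k)) * (X none ^ 2 * X (some 0))) + 2 * X none * X (some 2) - 3 * X none * (X (some 1) + (l.val : (MvPolynomial (Option (Fin 4)) k)) * (X none ^ 2 * X (some 0))) ^ 2)) ^ dbar)))) (X (some 1)), ((algebraMap (MvPolynomial (Option (Fin 4)) k) (Localization.Away ((cobordantAlgebra.subst k (![3, 1, 2, 0] : Fin 4 → ℕ) hh * (∏ l : ZMod p, (X (some 1) + (l.val : (MvPolynomial (Option (Fin 4)) k)) * (X none ^ 2 * X (some 0)))) ^ n₁) * ((∏ l : ZMod p, (C (2 * (1 - 3 * a)) * (X (some 1) + (l.val : (MvPolynomial (Option (Fin 4)) k)) * (X none ^ 2 * X (some 0))) + 2 * X none * X (some 2) - 3 * X none * (X (some 1) + (l.val : (MvPolynomial (Option (Fin 4)) k)) * (X none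 ^ 2 * X (some 0))) ^ 2)) ^ dbar)))) : (MvPolynomial (Option (Fin 4)) k) →+* (Localization.Away ((cobordantAlgebra.subst k (![3, 1, 2, 0] : Fin 4 → ℕ) hh * (∏ l : ZMod p, (X (some 1) + (l.val : (MvPolynomial (Option (Fin 4)) k)) * (X none ^ 2 * X (some 0)))) ^ n₁) * ((∏ l : ZMod p, (C (2 * (1 - 3 * a)) * (X (some 1) + (l.val : (MvPolynomial (Option (Fin 4)) k)) * (X none ^ 2 * X (some 0))) + 2 * X none * X (some 2) - 3 * X none * (X (some 1) + (l.val : (MvPolynomial (Option (Fin 4)) k)) * (X none ^ 2 * X (some 0))) ^ 2)) ^ dbar)))) (X (some 2)), ((algebraMap (MvPolynomial (Option (Fin 4)) k) (Localization.Away ((cobordantAlgebra.subst k (![3, 1, 2, 0] : Fin 4 → ℕ) hh * (∏ l : ZMod p, (X (some 1) + (l.val : (MvPolynomial (Option (Fin 4)) k)) * (X none ^ 2 * X (some 0)))) ^ n₁) * ((∏ l : ZMod p, (C (2 * (1 - 3 * a)) * (X (some 1) + (l.val : (MvPolynomial (Option (Fin 4)) k)) * (X none ^ 2 * X (some 0)))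 + 2 * X none * X (some 2) - 3 * X none * (X (some 1) + (l.val : (MvPolynomial (Option (Fin 4)) k)) * (X none ^ 2 * X (some 0))) ^ 2)) ^ dbar)))) : (MvPolynomial (Option (Fin 4)) k) →+* (Localization.Away ((cobordantAlgebra.subst k (![3, 1, 2, 0] : Fin 4 → ℕ) hh * (∏ l : ZMod p, (X (some 1) + (l.val : (MvPolynomial (Option (Fin 4)) k)) * (X none ^ 2 * X (some 0)))) ^ n₁) * ((∏ l : ZMod p, (C (2 * (1 - 3 * a)) * (X (some 1) + (l.val : (MvPolynomial (Option (Fin 4)) k)) * (X none ^ 2 * X (some 0))) + 2 * X none * X (some 2) - 3 * X none * (X (some 1) + (l.val : (MvPolynomial (Option (Fin 4)) k)) * (X none ^ 2 * X (some 0))) ^ 2)) ^ dbar)))) (X (some 3))} : Set (Localization.Away ((cobordantAlgebra.subst k (![3, 1, 2, 0] : Fin 4 → ℕ) hh * (∏ l : ZMod p, (X (some 1) + (l.val : (MvPolynomial (Option (Fin 4)) k)) * (X none ^ 2 * X (some 0)))) ^ n₁) * ((∏ l : ZMod p, (C (2 * (1 - 3 * a)) * (X (some 1) + (l.val : (MvPolynomial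 (Option (Fin 4)) k)) * (X none ^ 2 * X (some 0))) + 2 * X none * X (some 2) - 3 * X none * (X (some 1) + (l.val : (MvPolynomial (Option (Fin 4)) k)) * (X none ^ 2 * X (some 0))) ^ 2)) ^ dbar)))) ∪ (({IsLocalization.Away.invSelf ((cobordantAlgebra.subst k (![3, 1, 2, 0] : Fin 4 → ℕ) hh * (∏ l : ZMod p, (X (some 1) + (l.val : (MvPolynomial (Option (Fin 4)) k)) * (X none ^ 2 * X (some 0)))) ^ n₁) * ((∏ l : ZMod p, (C (2 * (1 - 3 * a)) * (X (some 1) + (l.val : (MvPolynomial (Option (Fin 4)) k)) * (X none ^ 2 * X (some 0))) + 2 * X none * X (some 2) - 3 * X none * (X (some 1) + (l.val : (MvPolynomial (Option (Fin 4)) k)) * (X none ^ 2 * X (some 0))) ^ 2)) ^ dbar))} : Set (Localization.Away ((cobordantAlgebra.subst k (![3, 1, 2, 0] : Fin 4 → ℕ) hh * (∏ l : ZMod p, (X (some 1) + (l.val : (MvPolynomial (Option (Fin 4)) k)) * (X none ^ 2 * X (some 0)))) ^ n₁) * ((∏ l : ZMod p, (C (2 * (1 - 3 * a)) * (X (some 1)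 + (l.val : (MvPolynomial (Option (Fin 4)) k)) * (X none ^ 2 * X (some 0))) + 2 * X none * X (some 2) - 3 * X none * (X (some 1) + (l.val : (MvPolynomial (Option (Fin 4)) k)) * (X none ^ 2 * X (some 0))) ^ 2)) ^ dbar)))) ∪ Set.range (algebraMap k (Localization.Away ((cobordantAlgebra.subst k (![3, 1, 2, 0] : Fin 4 → ℕ) hh * (∏ l : ZMod p, (X (some 1) + (l.val : (MvPolynomial (Option (Fin 4)) k)) * (X none ^ 2 * X (some 0)))) ^ n₁) * ((∏ l : ZMod p, (C (2 * (1 - 3 * a)) * (X (some 1) + (l.val : (MvPolynomial (Option (Fin 4)) k)) * (X none ^ 2 * X (some 0))) + 2 * X none * X (some 2) - 3 * X none * (X (some 1) + (l.val : (MvPolynomial (Option (Fin 4)) k)) * (X none ^ 2 * X (some 0))) ^ 2)) ^ dbar)))))) = ⊤ :=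
    A1.a1_model_closure_eq_top _
  -- ### degrees
  have dX0 := KillCert.QhAway.qhc_degree_u' (![3, 1, 2] : Fin 3 → ℕ) hh mo 𝒜 hf y hy Φ hΦu 0
  have dX1 := KillCert.QhAway.qhc_degree_u' (![3, 1, 2] : Fin 3 → ℕ) hh mo 𝒜 hf y hy Φ hΦu 1
  have dX2 := KillCert.QhAway.qhc_degree_u' (![3, 1, 2] : Fin 3 → ℕ) hh mo 𝒜 hf y hy Φ hΦu 2
  have dφ : (algebraMap (MvPolynomial (Option (Fin 4)) k) (Localization.Away (cobordantAlgebra.subst k (![3, 1, 2, 0] : Fin 4 → ℕ) hh * (∏ l : ZMod p, (X (some 1) + (l.val : (MvPolynomial (Option (Fin 4)) k)) * (X none ^ 2 * X (some 0)))) ^ n₁))) (X none ^ 2 * X (some 2) ^ 2 + 2 * X none * X (some 2) * X (some 1) + C (2 * c) * X (some 2) + C (1 - 3 * a) * X (some 1) ^ 2 - X none * X (some 1) ^ 3 : MvPolynomial (Option (Fin 4)) k) ∈ mapGrading (chartNodeGrading mo 𝒜 (fun i => algebraMap (MvPolynomial (Fin 4) k) (Localization.Away hh) (X ((![0, 1,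 2] : Fin 3 → Fin 4) i))) (![3, 1, 2] : Fin 3 → ℕ) hf dbar y hy) Φ (2 • (consIndexEquiv mo ((1 : ℤ), (0 : Π j : Fin mg, ZMod (mo j))))) := by
    rw [← hφeq]; exact KillCert.QhAway.qhc_degree_tail (X 2 ^ 2 + 2 * X 1 * X 2 + C (2 * c) * X 2 + C (1 - 3 * a) * X 1 ^ 2 - X 1 ^ 3 : MvPolynomial (Fin 4) k) (![3, 1, 2] : Fin 3 → ℕ) 2 hh mo 𝒜 hf y hy Φ ht (hfull 0 _)
  -- degree of `x_none` (`-θ`), of the constants (`0`) and of `h_Q` (`θ`)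
  have dS : (algebraMap (MvPolynomial (Option (Fin 4)) k) (Localization.Away (cobordantAlgebra.subst k (![3, 1, 2, 0] : Fin 4 → ℕ) hh * (∏ l : ZMod p, (X (some 1) + (l.val : (MvPolynomial (Option (Fin 4)) k)) * (X none ^ 2 * X (some 0)))) ^ n₁))) (X none) ∈ mapGrading (chartNodeGrading mo 𝒜 (fun i => algebraMap (MvPolynomial (Fin 4) k) (Localization.Away hh) (X ((![0, 1, 2] : Fin 3 → Fin 4) i))) (![3, 1, 2] : Fin 3 → ℕ) hf dbar y hy) Φ (-(consIndexEquiv mo ((1 : ℤ), (0 : Π j : Fin mg, ZMod (mo j))))) := by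
    rw [← hΦs, ← neg_one_zsmul, ← consIndexEquiv_int_zero]
    exact FreeModel.map_algebraMap_mem_mapGrading mo 𝒜 (fun i => algebraMap (MvPolynomial (Fin 4) k) (Localization.Away hh) (X ((![0, 1, 2] : Fin 3 → Fin 4) i))) (![3, 1, 2] : Fin 3 → ℕ) hf dbar y hy Φ (s_mem_reesPiece 𝒜 (fun i => algebraMap (MvPolynomial (Fin 4) k) (Localization.Away hh) (X ((![0, 1, 2] : Fin 3 → Fin 4) i))) (![3, 1, 2] : Fin 3 → ℕ))
  have dC : ∀ a' : k, (algebraMap (MvPolynomial (Option (Fin 4)) k) (Localization.Away (cobordantAlgebra.subst k (![3, 1, 2, 0] : Fin 4 → ℕ) hh * (∏ l : ZMod p, (X (some 1) + (l.val : (MvPolynomial (Option (Fin 4)) k)) * (X none ^ 2 * X (some 0)))) ^ n₁))) (C a') ∈ mapGrading (chartNodeGrading mo 𝒜 (fun i => algebraMap (MvPolynomial (Fin 4) k) (Localization.Away hh) (X ((![0, 1, 2] : Fin 3 → Fin 4) i))) (![3, 1, 2] : Fin 3 → ℕ) hf dbar y hy) Φ 0 := fun a' => by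
    have h := FreeModel.map_algebraMap_mem_mapGrading mo 𝒜 (fun i => algebraMap (MvPolynomial (Fin 4) k) (Localization.Away hh) (X ((![0, 1, 2] : Fin 3 → Fin 4) i))) (![3, 1, 2] : Fin 3 → ℕ) hf dbar y hy Φ (algebraMap_mem_reesPiece 𝒜 (fun i => algebraMap (MvPolynomial (Fin 4) k) (Localization.Away hh) (X ((![0, 1, 2] : Fin 3 → Fin 4) i))) (![3, 1, 2] : Fin 3 → ℕ) (hfull 0 (algebraMap (MvPolynomial (Fin 4) k) (Localization.Away hh) (C a'))))
    rw [hΦa, hsubC, Prod.mk_zero_zero, map_zero] at h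
    exact h
  have hTH1 : (((![3, 1, 2] : Fin 3 → ℕ) 1 : ℕ)) • (consIndexEquiv mo ((1 : ℤ), (0 : Π j : Fin mg, ZMod (mo j)))) = (consIndexEquiv mo ((1 : ℤ), (0 : Π j : Fin mg, ZMod (mo j)))) := one_nsmul _
  have hTH2 : -(consIndexEquiv mo ((1 : ℤ), (0 : Π j : Fin mg, ZMod (mo j)))) + (((![3, 1, 2] : Fin 3 → ℕ) 2 : ℕ)) • (consIndexEquiv mo ((1 : ℤ), (0 : Π j : Fin mg, ZMod (mo j)))) = (consIndexEquiv mo ((1 : ℤ), (0 : Π j : Fin mg, ZMod (mo j)))) := by change -(consIndexEquiv mo ((1 : ℤ), (0 : Π j : Fin mg, ZMod (mo j)))) + 2 • (consIndexEquiv mo ((1 : ℤ), (0 : Π j : Fin mg, ZMod (mo j)))) = (consIndexEquiv mo ((1 : ℤ), (0 : Π j : Fin mg, ZMod (mo j)))); rw [two_nsmul, neg_add_cancel_left]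
  have hud : (algebraMap (MvPolynomial (Option (Fin 4)) k) (Localization.Away (cobordantAlgebra.subst k (![3, 1, 2, 0] : Fin 4 → ℕ) hh * (∏ l : ZMod p, (X (some 1) + (l.val : (MvPolynomial (Option (Fin 4)) k)) * (X none ^ 2 * X (some 0)))) ^ n₁))) (C (2 * (1 - 3 * a)) * X (some 1) + 2 * X none * X (some 2) - 3 * X none * X (some 1) ^ 2 : MvPolynomial (Option (Fin 4)) k) ∈ mapGrading (chartNodeGrading mo 𝒜 (fun i => algebraMap (MvPolynomial (Fin 4) k) (Localization.Away hh) (X ((![0, 1, 2] : Fin 3 → Fin 4) i))) (![3, 1, 2] : Fin 3 → ℕ) hf dbar y hy) Φ (consIndexEquiv mo ((1 : ℤ), (0 : Π j : Fin mg, ZMod (mo j)))) := by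
    letI instP := mapGradedRing (chartNodeGrading mo 𝒜 (fun i => algebraMap (MvPolynomial (Fin 4) k) (Localization.Away hh) (X ((![0, 1, 2] : Fin 3 → Fin 4) i))) (![3, 1, 2] : Fin 3 → ℕ) hf dbar y hy) Φ
    have hA : (algebraMap (MvPolynomial (Option (Fin 4)) k) (Localization.Away (cobordantAlgebra.subst k (![3, 1, 2, 0] : Fin 4 → ℕ) hh * (∏ l : ZMod p, (X (some 1) + (l.val : (MvPolynomial (Option (Fin 4)) k)) * (X none ^ 2 * X (some 0)))) ^ n₁))) (C (2 * (1 - 3 * a))) * (algebraMap (MvPolynomial (Option (Fin 4)) k) (Localization.Away (cobordantAlgebra.subst k (![3, 1, 2, 0] : Fin 4 → ℕ) hh * (∏ l : ZMod p, (X (some 1) + (l.val : (MvPolynomial (Option (Fin 4)) k)) * (X none ^ 2 * X (some 0)))) ^ n₁))) (X (some 1)) ∈ mapGrading (chartNodeGrading mo 𝒜 (fun i => algebraMap (MvPolynomial (Fin 4) k) (Localization.Away hh) (X ((![0, 1, 2] : Fin 3 → Fin 4) i))) (![3, 1, 2] : Fin 3 → ℕ) hf dbar y hy) Φ (consIndexEquiv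 mo ((1 : ℤ), (0 : Π j : Fin mg, ZMod (mo j)))) := by
      have h := SetLike.mul_mem_graded (dC (2 * (1 - 3 * a))) dX1; rwa [zero_add, hTH1] at h
    have hB : (2 : (Localization.Away (cobordantAlgebra.subst k (![3, 1, 2, 0] : Fin 4 → ℕ) hh * (∏ l : ZMod p, (X (some 1) + (l.val : (MvPolynomial (Option (Fin 4)) k)) * (X none ^ 2 * X (some 0)))) ^ n₁))) * (algebraMap (MvPolynomial (Option (Fin 4)) k) (Localization.Away (cobordantAlgebra.subst k (![3, 1, 2, 0] : Fin 4 → ℕ) hh * (∏ l : ZMod p, (X (some 1) + (l.val : (MvPolynomial (Option (Fin 4)) k)) * (X none ^ 2 * X (some 0)))) ^ n₁))) (X none) * (algebraMap (MvPolynomial (Option (Fin 4)) k) (Localization.Away (cobordantAlgebra.subst k (![3, 1, 2, 0] : Fin 4 → ℕ) hh * (∏ l : ZMod p, (X (some 1) + (l.val : (MvPolynomial (Option (Fin 4)) k)) * (X none ^ 2 * X (some 0)))) ^ n₁))) (X (some 2)) ∈ mapGrading (chartNodeGrading mo 𝒜 (fun i => algebraMap (MvPolynomial (Fin 4) k) (Localization.Away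 hh) (X ((![0, 1, 2] : Fin 3 → Fin 4) i))) (![3, 1, 2] : Fin 3 → ℕ) hf dbar y hy) Φ (consIndexEquiv mo ((1 : ℤ), (0 : Π j : Fin mg, ZMod (mo j)))) := by
      have h := SetLike.mul_mem_graded (SetLike.mul_mem_graded (SetLike.natCast_mem_graded (mapGrading (chartNodeGrading mo 𝒜 (fun i => algebraMap (MvPolynomial (Fin 4) k) (Localization.Away hh) (X ((![0, 1, 2] : Fin 3 → Fin 4) i))) (![3, 1, 2] : Fin 3 → ℕ) hf dbar y hy) Φ) 2) dS) dX2
      rwa [zero_add, hTH2] at h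
    have hC' : (3 : (Localization.Away (cobordantAlgebra.subst k (![3, 1, 2, 0] : Fin 4 → ℕ) hh * (∏ l : ZMod p, (X (some 1) + (l.val : (MvPolynomial (Option (Fin 4)) k)) * (X none ^ 2 * X (some 0)))) ^ n₁))) * (algebraMap (MvPolynomial (Option (Fin 4)) k) (Localization.Away (cobordantAlgebra.subst k (![3, 1, 2, 0] : Fin 4 → ℕ) hh * (∏ l : ZMod p, (X (some 1) + (l.val : (MvPolynomial (Option (Fin 4)) k)) * (X none ^ 2 * X (some 0)))) ^ n₁))) (X none) * (algebraMap (MvPolynomial (Option (Fin 4)) k) (Localization.Away (cobordantAlgebra.subst k (![3, 1, 2, 0] : Fin 4 → ℕ) hh * (∏ l : ZMod p, (X (some 1) + (l.val : (MvPolynomial (Option (Fin 4)) k)) * (X none ^ 2 * X (some 0)))) ^ n₁))) (X (some 1)) ^ 2 ∈ mapGrading (chartNodeGrading mo 𝒜 (fun i => algebraMap (MvPolynomial (Fin 4) k) (Localization.Away hh) (X ((![0, 1, 2] : Fin 3 → Fin 4) i))) (![3, 1, 2] : Fin 3 → ℕ) hf dbar y hy) Φ (consIndexEquiv mo ((1 :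 ℤ), (0 : Π j : Fin mg, ZMod (mo j)))) := by
      have h := SetLike.mul_mem_graded (SetLike.mul_mem_graded (SetLike.natCast_mem_graded (mapGrading (chartNodeGrading mo 𝒜 (fun i => algebraMap (MvPolynomial (Fin 4) k) (Localization.Away hh) (X ((![0, 1, 2] : Fin 3 → Fin 4) i))) (![3, 1, 2] : Fin 3 → ℕ) hf dbar y hy) Φ) 3) dS) (SetLike.pow_mem_graded 2 dX1)
      rwa [zero_add, hTH1, two_nsmul, neg_add_cancel_left] at h
    have h := sub_mem (add_mem hA hB) hC'
    simpa only [map_sub, map_add, map_mul, map_pow, map_ofNat] using h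
  have hX₀d : (algebraMap (MvPolynomial (Option (Fin 4)) k) (Localization.Away (cobordantAlgebra.subst k (![3, 1, 2, 0] : Fin 4 → ℕ) hh * (∏ l : ZMod p, (X (some 1) + (l.val : (MvPolynomial (Option (Fin 4)) k)) * (X none ^ 2 * X (some 0)))) ^ n₁))) (X (some 0)) ∈ mapGrading (chartNodeGrading mo 𝒜 (fun i => algebraMap (MvPolynomial (Fin 4) k) (Localization.Away hh) (X ((![0, 1, 2] : Fin 3 → Fin 4) i))) (![3, 1, 2] : Fin 3 → ℕ) hf dbar y hy) Φ (3 • (consIndexEquiv mo ((1 : ℤ), (0 : Π j : Fin mg, ZMod (mo j))))) := dX0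
  have hφd : (algebraMap (MvPolynomial (Option (Fin 4)) k) (Localization.Away (cobordantAlgebra.subst k (![3, 1, 2, 0] : Fin 4 → ℕ) hh * (∏ l : ZMod p, (X (some 1) + (l.val : (MvPolynomial (Option (Fin 4)) k)) * (X none ^ 2 * X (some 0)))) ^ n₁))) (X none ^ 2 * X (some 2) ^ 2 + 2 * X none * X (some 2) * X (some 1) + C (2 * c) * X (some 2) + C (1 - 3 * a) * X (some 1) ^ 2 - X none * X (some 1) ^ 3 : MvPolynomial (Option (Fin 4)) k) ∈ mapGrading (chartNodeGrading mo 𝒜 (fun i => algebraMap (MvPolynomial (Fin 4) k) (Localization.Away hh) (X ((![0, 1, 2] : Fin 3 → Fin 4) i))) (![3, 1, 2] : Fin 3 → ℕ) hf dbar y hy) Φ (2 • (consIndexEquiv mo ((1 : ℤ), (0 : Π j : Fin mg, ZMod (mo j))))) := dφ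
  -- ### rows in the shape of the abstract member theorem
  have h1' : conj Φ (sigmaChart 𝒜 (fun i => algebraMap (MvPolynomial (Fin 4) k) (Localization.Away hh) (X ((![0, 1, 2] : Fin 3 → Fin 4) i))) (![3, 1, 2] : Fin 3 → ℕ) dbar y hy (sigmaAway σ hσh) hσJ hp hσpL hσy) ((algebraMap (MvPolynomial (Option (Fin 4)) k) (Localization.Away (cobordantAlgebra.subst k (![3, 1, 2, 0] : Fin 4 → ℕ) hh * (∏ l : ZMod p, (X (some 1) + (l.val : (MvPolynomial (Option (Fin 4)) k)) * (X none ^ 2 * X (some 0)))) ^ n₁))) (X (some 1))) = (algebraMap (MvPolynomial (Option (Fin 4)) k) (Localization.Away (cobordantAlgebra.subst k (![3, 1, 2, 0] : Fin 4 → ℕ) hh * (∏ l : ZMod p, (X (some 1) + (l.val : (MvPolynomial (Option (Fin 4)) k)) * (X none ^ 2 * X (some 0)))) ^ n₁))) (X (some 1) + 1 * (X none ^ 2 * X (some 0))) := by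
    rw [row1]; simp only [map_add, map_mul, map_pow, one_mul]
  have h2' : conj Φ (sigmaChart 𝒜 (fun i => algebraMap (MvPolynomial (Fin 4) k) (Localization.Away hh) (X ((![0, 1, 2] : Fin 3 → Fin 4) i))) (![3, 1, 2] : Fin 3 → ℕ) dbar y hy (sigmaAway σ hσh) hσJ hp hσpL hσy) ((algebraMap (MvPolynomial (Option (Fin 4)) k) (Localization.Away (cobordantAlgebra.subst k (![3, 1, 2, 0] : Fin 4 → ℕ) hh * (∏ l : ZMod p, (X (some 1) + (l.val : (MvPolynomial (Option (Fin 4)) k)) * (X none ^ 2 * X (some 0)))) ^ n₁))) (X (some 2))) = (algebraMap (MvPolynomial (Option (Fin 4)) k) (Localization.Away (cobordantAlgebra.subst k (![3, 1, 2, 0] : Fin 4 → ℕ) hh * (∏ l : ZMod p, (X (some 1) + (l.val : (MvPolynomial (Option (Fin 4)) k)) * (X none ^ 2 * X (some 0)))) ^ n₁))) (X (some 2) + 0 * (X none ^ 2 * X (some 0))) := by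
    rw [row2, zero_mul, add_zero]
  have h3' : conj Φ (sigmaChart 𝒜 (fun i => algebraMap (MvPolynomial (Fin 4) k) (Localization.Away hh) (X ((![0, 1, 2] : Fin 3 → Fin 4) i))) (![3, 1, 2] : Fin 3 → ℕ) dbar y hy (sigmaAway σ hσh) hσJ hp hσpL hσy) ((algebraMap (MvPolynomial (Option (Fin 4)) k) (Localization.Away (cobordantAlgebra.subst k (![3, 1, 2, 0] : Fin 4 → ℕ) hh * (∏ l : ZMod p, (X (some 1) + (l.val : (MvPolynomial (Option (Fin 4)) k)) * (X none ^ 2 * X (some 0)))) ^ n₁))) (X (some 3))) = (algebraMap (MvPolynomial (Option (Fin 4)) k) (Localization.Away (cobordantAlgebra.subst k (![3, 1, 2, 0] : Fin 4 → ℕ) hh * (∏ l : ZMod p, (X (some 1) + (l.val : (MvPolynomial (Option (Fin 4)) k)) * (X none ^ 2 * X (some 0)))) ^ n₁))) (X (some 3) + X none ^ 2 * (X none ^ 2 * X (some 2) ^ 2 + 2 * X none * X (some 2) * X (some 1) + C (2 * c) * X (some 2) + C (1 - 3 * a) * X (some 1) ^ 2 - X none * X (some 1) ^ 3 : MvPolynomial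 (Option (Fin 4)) k)) := by
    rw [row3]; simp only [map_add, map_mul, map_pow]
  have hφ' : conj Φ (sigmaChart 𝒜 (fun i => algebraMap (MvPolynomial (Fin 4) k) (Localization.Away hh) (X ((![0, 1, 2] : Fin 3 → Fin 4) i))) (![3, 1, 2] : Fin 3 → ℕ) dbar y hy (sigmaAway σ hσh) hσJ hp hσpL hσy) ((algebraMap (MvPolynomial (Option (Fin 4)) k) (Localization.Away (cobordantAlgebra.subst k (![3, 1, 2, 0] : Fin 4 → ℕ) hh * (∏ l : ZMod p, (X (some 1) + (l.val : (MvPolynomial (Option (Fin 4)) k)) * (X none ^ 2 * X (some 0)))) ^ n₁))) (X none ^ 2 * X (some 2) ^ 2 + 2 * X none * X (some 2) * X (some 1) + C (2 * c) * X (some 2) + C (1 - 3 * a) * X (some 1) ^ 2 - X none * X (some 1) ^ 3 : MvPolynomial (Option (Fin 4)) k)) = (algebraMap (MvPolynomial (Option (Fin 4)) k) (Localization.Away (cobordantAlgebra.subst k (![3, 1, 2, 0] : Fin 4 → ℕ) hh * (∏ l : ZMod p, (X (some 1) + (l.val : (MvPolynomial (Option (Fin 4)) k)) * (X none ^ 2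 * X (some 0)))) ^ n₁))) ((X none ^ 2 * X (some 2) ^ 2 + 2 * X none * X (some 2) * X (some 1) + C (2 * c) * X (some 2) + C (1 - 3 * a) * X (some 1) ^ 2 - X none * X (some 1) ^ 3 : MvPolynomial (Option (Fin 4)) k) + X none ^ 2 * X (some 0) * (C (2 * (1 - 3 * a)) * X (some 1) + 2 * X none * X (some 2) - 3 * X none * X (some 1) ^ 2 : MvPolynomial (Option (Fin 4)) k) + (X none ^ 2 * X (some 0)) ^ 2 * (C (1 - 3 * a) - 3 * X none * X (some 1) - X none ^ 3 * X (some 0) : MvPolynomial (Option (Fin 4)) k)) := by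
    have e : (algebraMap (MvPolynomial (Option (Fin 4)) k) (Localization.Away (cobordantAlgebra.subst k (![3, 1, 2, 0] : Fin 4 → ℕ) hh * (∏ l : ZMod p, (X (some 1) + (l.val : (MvPolynomial (Option (Fin 4)) k)) * (X none ^ 2 * X (some 0)))) ^ n₁))) (X none ^ 2 * X (some 2) ^ 2 + 2 * X none * X (some 2) * X (some 1) + C (2 * c) * X (some 2) + C (1 - 3 * a) * X (some 1) ^ 2 - X none * X (some 1) ^ 3 : MvPolynomial (Option (Fin 4)) k) = (algebraMap (MvPolynomial (Option (Fin 4)) k) (Localization.Away (cobordantAlgebra.subst k (![3, 1, 2, 0] : Fin 4 → ℕ) hh * (∏ l : ZMod p, (X (some 1) + (l.val : (MvPolynomial (Option (Fin 4)) k)) * (X none ^ 2 * X (some 0)))) ^ n₁))) (X none) ^ 2 * (algebraMap (MvPolynomial (Option (Fin 4)) k) (Localization.Away (cobordantAlgebra.subst k (![3, 1, 2, 0] : Fin 4 → ℕ) hh * (∏ l : ZMod p, (X (some 1) + (l.val : (MvPolynomial (Option (Fin 4)) k)) * (X none ^ 2 * X (some 0)))) ^ n₁))) (X (some 2)) ^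 2 + 2 * (algebraMap (MvPolynomial (Option (Fin 4)) k) (Localization.Away (cobordantAlgebra.subst k (![3, 1, 2, 0] : Fin 4 → ℕ) hh * (∏ l : ZMod p, (X (some 1) + (l.val : (MvPolynomial (Option (Fin 4)) k)) * (X none ^ 2 * X (some 0)))) ^ n₁))) (X none) * (algebraMap (MvPolynomial (Option (Fin 4)) k) (Localization.Away (cobordantAlgebra.subst k (![3, 1, 2, 0] : Fin 4 → ℕ) hh * (∏ l : ZMod p, (X (some 1) + (l.val : (MvPolynomial (Option (Fin 4)) k)) * (X none ^ 2 * X (some 0)))) ^ n₁))) (X (some 2)) * (algebraMap (MvPolynomial (Option (Fin 4)) k) (Localization.Away (cobordantAlgebra.subst k (![3, 1, 2, 0] : Fin 4 → ℕ) hh * (∏ l : ZMod p, (X (some 1) + (l.val : (MvPolynomial (Option (Fin 4)) k)) * (X none ^ 2 * X (some 0)))) ^ n₁))) (X (some 1)) + (algebraMap (MvPolynomial (Option (Fin 4)) k) (Localization.Away (cobordantAlgebra.subst k (![3, 1, 2, 0] : Fin 4 → ℕ) hh * (∏ l : ZMod p, (X (some 1) + (l.val : (MvPolynomial (Option (Fin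 4)) k)) * (X none ^ 2 * X (some 0)))) ^ n₁))) (C (2 * c)) * (algebraMap (MvPolynomial (Option (Fin 4)) k) (Localization.Away (cobordantAlgebra.subst k (![3, 1, 2, 0] : Fin 4 → ℕ) hh * (∏ l : ZMod p, (X (some 1) + (l.val : (MvPolynomial (Option (Fin 4)) k)) * (X none ^ 2 * X (some 0)))) ^ n₁))) (X (some 2)) +
        (algebraMap (MvPolynomial (Option (Fin 4)) k) (Localization.Away (cobordantAlgebra.subst k (![3, 1, 2, 0] : Fin 4 → ℕ) hh * (∏ l : ZMod p, (X (some 1) + (l.val : (MvPolynomial (Option (Fin 4)) k)) * (X none ^ 2 * X (some 0)))) ^ n₁))) (C (1 - 3 * a)) * (algebraMap (MvPolynomial (Option (Fin 4)) k) (Localization.Away (cobordantAlgebra.subst k (![3, 1, 2, 0] : Fin 4 → ℕ) hh * (∏ l : ZMod p, (X (some 1) + (l.val : (MvPolynomial (Option (Fin 4)) k)) * (X none ^ 2 * X (some 0)))) ^ n₁))) (X (some 1)) ^ 2 - (algebraMap (MvPolynomial (Option (Fin 4)) k) (Localization.Away (cobordantAlgebra.subst k (![3, 1, 2, 0] : Fin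 4 → ℕ) hh * (∏ l : ZMod p, (X (some 1) + (l.val : (MvPolynomial (Option (Fin 4)) k)) * (X none ^ 2 * X (some 0)))) ^ n₁))) (X none) * (algebraMap (MvPolynomial (Option (Fin 4)) k) (Localization.Away (cobordantAlgebra.subst k (![3, 1, 2, 0] : Fin 4 → ℕ) hh * (∏ l : ZMod p, (X (some 1) + (l.val : (MvPolynomial (Option (Fin 4)) k)) * (X none ^ 2 * X (some 0)))) ^ n₁))) (X (some 1)) ^ 3 := by simp only [map_sub, map_add, map_mul, map_pow, map_ofNat]
    rw [e]
    simp only [map_sub, map_add, map_mul, map_pow, map_ofNat, row2, row1, rn, rC]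
    ring
  have hXR : (X none ^ 2 * X (some 2) ^ 2 + 2 * X none * X (some 2) * X (some 1) + C (2 * c) * X (some 2) + C (1 - 3 * a) * X (some 1) ^ 2 - X none * X (some 1) ^ 3 : MvPolynomial (Option (Fin 4)) k) = 1 * (X none ^ 2 * X (some 2) ^ 2 + 2 * X none * X (some 2) * X (some 1) + C (2 * c) * X (some 2) + C (1 - 3 * a) * X (some 1) ^ 2 - X none * X (some 1) ^ 3 : MvPolynomial (Option (Fin 4)) k) := (one_mul _).symm
  -- ### the member on `D(b)`, presented by sections
  obtain ⟨a', bb, ha', hbb', d₀, hd₀, hK⟩ := exists_memberSections_away₂ hG M W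
    ({ affine := hW, m := mg + 1, r := Fin.cons 0 mo, B := (ChartRing 𝒜 (fun i => algebraMap (MvPolynomial (Fin 4) k) (Localization.Away hh) (X ((![0, 1, 2] : Fin 3 → Fin 4) i))) (![3, 1, 2] : Fin 3 → ℕ) dbar y hy), 𝒜 := (chartNodeGrading mo 𝒜 (fun i => algebraMap (MvPolynomial (Fin 4) k) (Localization.Away hh) (X ((![0, 1, 2] : Fin 3 → Fin 4) i))) (![3, 1, 2] : Fin 3 → ℕ) hf dbar y hy), σ := (sigmaChart 𝒜 (fun i => algebraMap (MvPolynomial (Fin 4) k) (Localization.Away hh) (X ((![0, 1, 2] : Fin 3 → Fin 4) i))) (![3, 1, 2] : Fin 3 → ℕ) dbar y hy (sigmaAway σ hσh) hσJ hp hσpL hσy), e := E, tame := htame, intertwine := hE } : NodeData p M.act g₀ W)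
    (cobordantAlgebra.subst k (![3, 1, 2, 0] : Fin 4 → ℕ) hh * (∏ l : ZMod p, (X (some 1) + (l.val : (MvPolynomial (Option (Fin 4)) k)) * (X none ^ 2 * X (some 0)))) ^ n₁) ((∏ l : ZMod p, (C (2 * (1 - 3 * a)) * (X (some 1) + (l.val : (MvPolynomial (Option (Fin 4)) k)) * (X none ^ 2 * X (some 0))) + 2 * X none * X (some 2) - 3 * X none * (X (some 1) + (l.val : (MvPolynomial (Option (Fin 4)) k)) * (X none ^ 2 * X (some 0))) ^ 2)) ^ dbar) Φ b hσbE Φ' hpin (X (some 1)) (X (some 2)) (X none ^ 2 * X (some 2) ^ 2 + 2 * X none * X (some 2) * X (some 1) + C (2 * c) * X (some 2) + C (1 - 3 * a) * X (some 1) ^ 2 - X none * X (some 1) ^ 3 : MvPolynomial (Option (Fin 4)) k) (X none ^ 2 * X (some 2) ^ 2 + 2 * X none * X (some 2) * X (some 1) + C (2 * c) * X (some 2) + C (1 - 3 * a) * X (some 1) ^ 2 - X none * X (some 1) ^ 3 : MvPolynomial (Option (Fin 4)) k) 1 1 0 (C (2 * (1 - 3 * a)) * X (some 1) + 2 * X none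 * X (some 2) - 3 * X none * X (some 1) ^ 2 : MvPolynomial (Option (Fin 4)) k) (C (1 - 3 * a) - 3 * X none * X (some 1) - X none ^ 3 * X (some 0) : MvPolynomial (Option (Fin 4)) k) 2
    rn row0 h1' h2' h3' hφ' rC hτq hXR hQ₁ hHU hQ₁ hgen hK1 hK1' (consIndexEquiv mo ((1 : ℤ), (0 : Π j : Fin mg, ZMod (mo j)))) (consIndexEquiv mo ((1 : ℤ), (0 : Π j : Fin mg, ZMod (mo j)))) 3 2 (C (2 * (1 - 3 * a)) * X (some 1) + 2 * X none * X (some 2) - 3 * X none * X (some 1) ^ 2 : MvPolynomial (Option (Fin 4)) k) (C (2 * (1 - 3 * a)) * X (some 1) + 2 * X none * X (some 2) - 3 * X none * X (some 1) ^ 2 : MvPolynomial (Option (Fin 4)) k) hHU hHU hud hud hX₀d hφd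
  -- ### relations with the pulled-back sections `π^*x₀`, `π^*ξf`, `π^*f_Q` (✓`memberSection_relation`)
  have hEr0 : Φ ((E r0 : ↥((chartNodeGrading mo 𝒜 (fun i => algebraMap (MvPolynomial (Fin 4) k) (Localization.Away hh) (X ((![0, 1, 2] : Fin 3 → Fin 4) i))) (![3, 1, 2] : Fin 3 → ℕ) hf dbar y hy) 0)) : (ChartRing 𝒜 (fun i => algebraMap (MvPolynomial (Fin 4) k) (Localization.Away hh) (X ((![0, 1, 2] : Fin 3 → Fin 4) i))) (![3, 1, 2] : Fin 3 → ℕ) dbar y hy)) = (algebraMap (MvPolynomial (Option (Fin 4)) k) (Localization.Away (cobordantAlgebra.subst k (![3, 1, 2, 0] : Fin 4 → ℕ) hh * (∏ l : ZMod p, (X (some 1) + (l.val : (MvPolynomial (Option (Fin 4)) k)) * (X none ^ 2 * X (some 0)))) ^ n₁))) (X none ^ 3 * X (some 0)) := by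
    rw [hr0]; refine (hΦa (X 0)).trans ?_; rw [hsubX]; rfl
  have hsubXI : cobordantAlgebra.subst k (![3, 1, 2, 0] : Fin 4 → ℕ) (2 * X 2 + C (2 * (1 - 3 * a)) * X 1 - 3 * X 1 ^ 2 : MvPolynomial (Fin 4) k) = X none * (C (2 * (1 - 3 * a)) * X (some 1) + 2 * X none * X (some 2) - 3 * X none * X (some 1) ^ 2 : MvPolynomial (Option (Fin 4)) k) := by
    simp only [map_sub, map_add, map_mul, map_pow, map_ofNat, hsubX, hsubC, Matrix.cons_val_one, Matrix.cons_val_two, Matrix.cons_val_zero, Matrix.head_cons, Matrix.tail_cons]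
    ring
  have hErxi : Φ ((E rxi : ↥((chartNodeGrading mo 𝒜 (fun i => algebraMap (MvPolynomial (Fin 4) k) (Localization.Away hh) (X ((![0, 1, 2] : Fin 3 → Fin 4) i))) (![3, 1, 2] : Fin 3 → ℕ) hf dbar y hy) 0)) : (ChartRing 𝒜 (fun i => algebraMap (MvPolynomial (Fin 4) k) (Localization.Away hh) (X ((![0, 1, 2] : Fin 3 → Fin 4) i))) (![3, 1, 2] : Fin 3 → ℕ) dbar y hy)) = (algebraMap (MvPolynomial (Option (Fin 4)) k) (Localization.Away (cobordantAlgebra.subst k (![3, 1, 2, 0] : Fin 4 → ℕ) hh * (∏ l : ZMod p, (X (some 1) + (l.val : (MvPolynomial (Option (Fin 4)) k)) * (X none ^ 2 * X (some 0)))) ^ n₁))) (X none * (C (2 * (1 - 3 * a)) * X (some 1) + 2 * X none * X (some 2) - 3 * X none * X (some 1) ^ 2 : MvPolynomial (Option (Fin 4)) k)) := by rw [hrxi, hΦa, hsubXI]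
  have hErt : Φ ((E rt : ↥((chartNodeGrading mo 𝒜 (fun i => algebraMap (MvPolynomial (Fin 4) k) (Localization.Away hh) (X ((![0, 1, 2] : Fin 3 → Fin 4) i))) (![3, 1, 2] : Fin 3 → ℕ) hf dbar y hy) 0)) : (ChartRing 𝒜 (fun i => algebraMap (MvPolynomial (Fin 4) k) (Localization.Away hh) (X ((![0, 1, 2] : Fin 3 → Fin 4) i))) (![3, 1, 2] : Fin 3 → ℕ) dbar y hy)) = (algebraMap (MvPolynomial (Option (Fin 4)) k) (Localization.Away (cobordantAlgebra.subst k (![3, 1, 2, 0] : Fin 4 → ℕ) hh * (∏ l : ZMod p, (X (some 1) + (l.val : (MvPolynomial (Option (Fin 4)) k)) * (X none ^ 2 * X (some 0)))) ^ n₁))) (X none ^ 2 * (X none ^ 2 * X (some 2) ^ 2 + 2 * X none * X (some 2) * X (some 1) + C (2 * c) * X (some 2) + C (1 - 3 * a) * X (some 1) ^ 2 - X none * X (some 1) ^ 3 : MvPolynomial (Option (Fin 4)) k)) := by rw [hrt, hΦa, hT']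
  have hrel_a := memberSection_relation M W
    ({ affine := hW, m := mg + 1, r := Fin.cons 0 mo, B := (ChartRing 𝒜 (fun i => algebraMap (MvPolynomial (Fin 4) k) (Localization.Away hh) (X ((![0, 1, 2] : Fin 3 → Fin 4) i))) (![3, 1, 2] : Fin 3 → ℕ) dbar y hy), 𝒜 := (chartNodeGrading mo 𝒜 (fun i => algebraMap (MvPolynomial (Fin 4) k) (Localization.Away hh) (X ((![0, 1, 2] : Fin 3 → Fin 4) i))) (![3, 1, 2] : Fin 3 → ℕ) hf dbar y hy), σ := (sigmaChart 𝒜 (fun i => algebraMap (MvPolynomial (Fin 4) k) (Localization.Away hh) (X ((![0, 1, 2] : Fin 3 → Fin 4) i))) (![3, 1, 2] : Fin 3 → ℕ) dbar y hy (sigmaAway σ hσh) hσJ hp hσpL hσy), e := E, tame := htame, intertwine := hE } : NodeData p M.act g₀ W)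
    (cobordantAlgebra.subst k (![3, 1, 2, 0] : Fin 4 → ℕ) hh * (∏ l : ZMod p, (X (some 1) + (l.val : (MvPolynomial (Option (Fin 4)) k)) * (X none ^ 2 * X (some 0)))) ^ n₁) ((∏ l : ZMod p, (C (2 * (1 - 3 * a)) * (X (some 1) + (l.val : (MvPolynomial (Option (Fin 4)) k)) * (X none ^ 2 * X (some 0))) + 2 * X none * X (some 2) - 3 * X none * (X (some 1) + (l.val : (MvPolynomial (Option (Fin 4)) k)) * (X none ^ 2 * X (some 0))) ^ 2)) ^ dbar) Φ b Φ' hpin2 a' (C (2 * (1 - 3 * a)) * X (some 1) + 2 * X none * X (some 2) - 3 * X none * X (some 1) ^ 2 : MvPolynomial (Option (Fin 4)) k) (X (some 0)) 3 ha' rxi r0 (X none * (C (2 * (1 - 3 * a)) * X (some 1) + 2 * X none * X (some 2) - 3 * X none * X (some 1) ^ 2 : MvPolynomial (Option (Fin 4)) k)) (X none ^ 3 * X (some 0)) (X none ^ 3) hErxi hEr0 (by ring) (by ring)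
  have hrel_b := memberSection_relation M W
    ({ affine := hW, m := mg + 1, r := Fin.cons 0 mo, B := (ChartRing 𝒜 (fun i => algebraMap (MvPolynomial (Fin 4) k) (Localization.Away hh) (X ((![0, 1, 2] : Fin 3 → Fin 4) i))) (![3, 1, 2] : Fin 3 → ℕ) dbar y hy), 𝒜 := (chartNodeGrading mo 𝒜 (fun i => algebraMap (MvPolynomial (Fin 4) k) (Localization.Away hh) (X ((![0, 1, 2] : Fin 3 → Fin 4) i))) (![3, 1, 2] : Fin 3 → ℕ) hf dbar y hy), σ := (sigmaChart 𝒜 (fun i => algebraMap (MvPolynomial (Fin 4) k) (Localization.Away hh) (X ((![0, 1, 2] : Fin 3 → Fin 4) i))) (![3, 1, 2] : Fin 3 → ℕ) dbar y hy (sigmaAway σ hσh) hσJ hp hσpL hσy), e := E, tame := htame, intertwine := hE } : NodeData p M.act g₀ W)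
    (cobordantAlgebra.subst k (![3, 1, 2, 0] : Fin 4 → ℕ) hh * (∏ l : ZMod p, (X (some 1) + (l.val : (MvPolynomial (Option (Fin 4)) k)) * (X none ^ 2 * X (some 0)))) ^ n₁) ((∏ l : ZMod p, (C (2 * (1 - 3 * a)) * (X (some 1) + (l.val : (MvPolynomial (Option (Fin 4)) k)) * (X none ^ 2 * X (some 0))) + 2 * X none * X (some 2) - 3 * X none * (X (some 1) + (l.val : (MvPolynomial (Option (Fin 4)) k)) * (X none ^ 2 * X (some 0))) ^ 2)) ^ dbar) Φ b Φ' hpin2 bb (C (2 * (1 - 3 * a)) * X (some 1) + 2 * X none * X (some 2) - 3 * X none * X (some 1) ^ 2 : MvPolynomial (Option (Fin 4)) k) (X none ^ 2 * X (some 2) ^ 2 + 2 * X none * X (some 2) * X (some 1) + C (2 * c) * X (some 2) + C (1 - 3 * a) * X (some 1) ^ 2 - X none * X (some 1) ^ 3 : MvPolynomial (Option (Fin 4)) k) 2 hbb' rxi rt (X none * (C (2 * (1 - 3 * a)) * X (some 1) + 2 * X none * X (some 2) - 3 * X none * X (some 1) ^ 2 : MvPolynomial (Option (Fin 4)) k))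 (X none ^ 2 * (X none ^ 2 * X (some 2) ^ 2 + 2 * X none * X (some 2) * X (some 1) + C (2 * c) * X (some 2) + C (1 - 3 * a) * X (some 1) ^ 2 - X none * X (some 1) ^ 3 : MvPolynomial (Option (Fin 4)) k)) (X none ^ 2) hErxi hErt (by ring) (by ring)
  exact ⟨b, _, M.V.basicOpen_le b, rfl, hEb, a', bb, hrel_a, hrel_b, d₀, hd₀, hK⟩

end Summit.ResolutionOfSingularities.ResolutionOfSingularities.Theorems.WildQuotientResolution.S1.GameFrame.GModel

end
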